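import Literature.NumberTheory.Rogawski1990.ArchPlaneSL2Model           -- ★ p848570 (T1): `archPlaneLift`, `_mul`, `_one`, `_unitary`, `hs_archPlaneLift`, `exists_archPlaneLift_eq_of_unitary`
import Literature.MeasureTheory.Group.SL2IwasawaHaar                     -- ★ `iwasawaMeasure`, `map_mul_left_iwasawaMeasure`, `iwasawaMeasure_compl_det_one`, `measurable_mul_left`
import Literature.NumberTheory.Automorphic.ArchLocalRegularOrbitClosed   -- ★ `locallyCompactSpace_archLocal`, `secondCountableTopology_archLocal` (the place carrier `archLocal`)
import Literature.NumberTheory.Automorphic.UnitaryFormGroupUnimodular    -- ★ `locallyCompactSpace_unitaryGroupOfForm_complex`, `secondCountableTopology_unitaryGroupOfForm_complex` (ED. 3)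
import Literature.NumberTheory.Rogawski1990.EndoscopicEmbedding          -- ★ `antidiagOne_map`
import Mathlib.MeasureTheory.Measure.Haar.Unique
import Literature.MeasureTheory.Group.SL2HSBallVolume                    -- ★ p848577 (LH3-p04): `exists_haarSL2pm_hsBall_le_linear` (ED. 2)
import Literature.MeasureTheory.Group.SL2CoordSetIntegral                -- ★ `lintegral_stripAbove`, `stripAbove_subset`, `measurableSet_stripAbove` (ED. 2)
import HarnessLib

/-!
# Every Haar measure of `U(Φ₂)(ℂ)_w ≅ U(1,1)` has linear Hilbert–Schmidt ball growth, given the same for `SL₂(ℝ)` — «(T2-out)»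
# (organ (T2e) of the (VOL)-plumbing behind the `stub_N9` pay-down line, LH3; Beuzart-Plessis 2020 §1.5; Borel 1997 §2.3, §4.1)

Topic `NumberTheory/Rogawski1990`; namespace `Literature.NumberTheory.Rogawski1990`.  TWO definitions with body (`archPlaneLiftGL`, `archPlaneLiftLocal`: the
`S¹ × SL₂(ℝ)` lift as an element of `GL₂(ℂ)` ∕ of the place carrier) + theorems; no instance, no notation, no named fact, no `sorry`.  Cell `pub/hodgecm-mathlib`,
F0∕P3c line LH3 (crux H413 = `stmt-HodgeConjecture-24833`); seat LH3-p02 (g0), deal #7 of LH3-plan (g0); lane `--supports stmt-HodgeConjecture-24833`.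
HONEST LABEL: HC_CM is proved only modulo the 7 printed citations (2 remaining: hLiu418 = stmt-HodgeConjecture-24832, h413 = stmt-HodgeConjecture-24833) until
rung 0 closes; this file is Haar-measure bookkeeping and pays no printed statement — it turns LH3-p04's `SL₂(ℝ)` volume growth (VOL-grp-SL2, taken here as the
HYPOTHESES `hSL`, `hSL0` on ★ `iwasawaMeasure`) into the per-place input «(T2-out)» of LH3-p03's (T3) «places multiply», hence of ★ p848470 (CONV): convergence of
the orbital integrals of Harish-Chandra Schwartz functions on `H_∞`, the analytic content of the line's two remaining LETTERS.

THE MATHEMATICS.  Let `X_w = U(σ_w Φ₂)(ℂ) ≤ GL₂(ℂ)` be the place carrier (★ `archLocal L 2 Φ₂ w`; membership = `Φ₂`-unitarity of the complex matrix, ★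
`antidiagOne_map`).  By (T1) ★ `ArchPlaneSL2Model`, `(z, r) ↦ z · D r D⁻¹` is a multiplicative `2 : 1` map `S¹ × SL₂(ℝ) ↠ X_w` preserving the Hilbert–Schmidt norm.
Push `μ_{S¹} ⊗ iwasawaMeasure` (`μ_{S¹}` = Haar on the circle; ★ `iwasawaMeasure` = `y⁻² dx dy dθ`, the Haar measure of `SL₂(ℝ)` [Borel1997, §2.3], [Lang, *SL₂(ℝ)*,
III §1]) forward to `X_w` (junk off `det r = 1`, a null set): the image `ν₀` is LEFT INVARIANT (every `x ∈ X_w` is a lift; ★ `archPlaneLift_mul`; ★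
`map_mul_left_iwasawaMeasure`), its HS-balls have mass `≤ μ(S¹) · iwasawaMeasure {Σ r² ≤ ρ}` (HS preserved), so it is FINITE ON COMPACTS (given linear growth for
`SL₂(ℝ)`) and NON-ZERO (given `iwasawaMeasure ≠ 0`); by UNIQUENESS of Haar measure on the locally compact second countable group `X_w` (Mathlib
`Measure.isMulLeftInvariant_eq_smul`) every Haar measure `ν` has `ν₀ = c • ν` with `c > 0`, whence `ν {Σ |g_ij|² ≤ ρ} ≤ c⁻¹ μ(S¹) · C · ρ`.
[BeuzartPlessis2020Asterisque, §1.5 (1.5.2)–(1.5.3) p. 31: polynomial growth of the volume of balls, here with the sharp exponent for `U(1,1)`.]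
* §1 `mem_archLocal_antidiag_two_iff`, `archPlaneLiftGL`, `archPlaneLiftGL_mem`, `archPlaneLiftLocal`, `coe_archPlaneLiftLocal`, `continuous_archPlaneLift_uncurry'`,
  `measurable_archPlaneLiftLocal`, `ae_det_eq_one`;
* §3 (ED. 2, append-only + 2 imports) the two inputs DISCHARGED from LH3-p04's ★ `SL2HSBallVolume` (`exists_iwasawaMeasure_hsBall_le_linear`, via
  `iwasawaMeasure ≤ haarSL2pm`) and ★ `SL2IwasawaHaar`∕`SL2CoordSetIntegral` (`iwasawaMeasure_ne_zero`: the strip `{|x| ≤ ½, y > 1}` has hyperbolic area `1`),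
  and the UNCONDITIONAL «(T2-out)» **`haar_archLocal_two_hsBall_le_linear`**.
* §5–§6 (ED. 3, append-only + 1 import) the same two statements over the FIELD-FREE carrier `↥(unitaryGroupOfForm (starRingEnd ℂ) Φ₂)` (the currency of LH3-p03's
  ★ `ArchHSBallVolumeProduct` §3 hypothesis `hT2`): `haar_unitaryGroupOfForm_antidiag_two_hsBall_le` and **`haar_unitaryGroupOfForm_antidiag_two_hsBall_le_linear`**.
* §7–§8 (ED. 4, append-only, no import added) the COMPARISON behind «(T2-out)» exported for both carriers (LH2-p04's (VOL-split-measure) input): for Haar `μ` on `S¹` and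
  Haar `ν` on the carrier, `∃ κ ∈ (0, ∞), ∀ S measurable ⊆ M₂(ℂ), ν {g ∣ (g : M₂(ℂ)) ∈ S} = κ · (μ ⊗ iwasawaMeasure) {(z, r) ∣ archPlaneLift z r ∈ S}` —
  `exists_measure_archLocal_two_eq_mul_prod_preimage_archPlaneLift`, `exists_measure_unitaryGroupOfForm_antidiag_two_eq_mul_prod_preimage_archPlaneLift`.
* §2 **`haar_archLocal_two_hsBall_le`** = «(T2-out)»: `(hSL : ∃ C, ∀ ρ ≥ 2, iwasawaMeasure {Σ r² ≤ ρ} ≤ C ρ) (hSL0 : iwasawaMeasure ≠ 0) (ν) [IsHaarMeasure ν] :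
  ∃ C, ∀ ρ ≥ 2, ν {g ∣ Σ |g_ij|² ≤ ρ} ≤ C ρ`.

## References
* [BeuzartPlessis2020Asterisque] R. Beuzart-Plessis, Astérisque 418 (2020), §1.5 (1.5.2)–(1.5.3) p. 31.
* [Borel1997] A. Borel, *Automorphic Forms on SL₂(ℝ)*, Cambridge Tracts in Math. 130 (1997), §2.3 (Iwasawa decomposition and Haar measure), §4.1 (1)–(3) p. 48.
* [Rogawski1990] J. D. Rogawski, *Automorphic Representations of Unitary Groups in Three Variables*, Ann. of Math. Stud. 123 (1990), §3.1 p. 19.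
-/

set_option autoImplicit false

noncomputable section

open Complex MeasureTheory Literature.MeasureTheory.Group
open scoped Matrix ComplexConjugate NNReal ENNReal

namespace Literature.NumberTheory.Rogawski1990

/-! ## §1 The lift into the place carrier; §2 the Haar statement «(T2-out)» -/

section Subtype

open NumberField NumberField.InfinitePlace Literature.NumberTheory.Automorphic Literature.NumberTheory.Automorphic.UnitaryGroup

variable (L : Type) [Field L] (w : {w : InfinitePlace L // w.IsComplex})

/-- Membership in the place carrier `archLocal L 2 Φ₂ w = U(σ_w Φ₂)(ℂ)` is `Φ₂`-unitarity of the underlying complex matrix (★ `mem_archLocal_iff`, ★ `antidiagOne_map`).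
[cite: Rogawski1990, §3.1 p. 19] -/
theorem mem_archLocal_antidiag_two_iff (g : GL (Fin 2) ℂ) :
    g ∈ archLocal L 2 (Matrix.of fun i j : Fin 2 => if i.val + j.val + 1 = 2 then (1 : L) else 0) w ↔
      ((g : Matrix (Fin 2) (Fin 2) ℂ).map (starRingEnd ℂ))ᵀ * (Matrix.of fun i j : Fin 2 => if i.val + j.val + 1 = 2 then (1 : ℂ) else 0) *
          (g : Matrix (Fin 2) (Fin 2) ℂ) =
        (Matrix.of fun i j : Fin 2 => if i.val + j.val + 1 = 2 then (1 : ℂ) else 0) := by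
  rw [mem_archLocal_iff, antidiagOne_map]

/-- The lift of `(z, r) ∈ S¹ × SL₂(ℝ)` as an element of `GL₂(ℂ)`, with inverse the lift of `(z̄, adj r)` (★ `archPlaneLift_mul`, `r · adj r = det r · 1`).
[cite: Borel1997, §4.1 (1)–(3)] -/
def archPlaneLiftGL (z : Circle) (r : Matrix (Fin 2) (Fin 2) ℝ) (hr : r.det = 1) : GL (Fin 2) ℂ where
  val := archPlaneLift (z : ℂ) r
  inv := archPlaneLift (conj (z : ℂ)) r.adjugate
  val_inv := by
    rw [← archPlaneLift_mul, Matrix.mul_adjugate, hr, one_smul, Complex.mul_conj, Circle.normSq_coe, Complex.ofReal_one, archPlaneLift_one]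
  inv_val := by
    rw [← archPlaneLift_mul, Matrix.adjugate_mul, hr, one_smul, mul_comm, Complex.mul_conj, Circle.normSq_coe, Complex.ofReal_one,
      archPlaneLift_one]

/-- The lift lands in the place carrier `U(σ_w Φ₂)(ℂ)` (★ `archPlaneLift_unitary`). [cite: Rogawski1990, §3.1 p. 19] [cite: Borel1997, §4.1 (1)–(3)] -/
theorem archPlaneLiftGL_mem (z : Circle) (r : Matrix (Fin 2) (Fin 2) ℝ) (hr : r.det = 1) :
    archPlaneLiftGL z r hr ∈ archLocal L 2 (Matrix.of fun i j : Fin 2 => if i.val + j.val + 1 = 2 then (1 : L) else 0) w :=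
  (mem_archLocal_antidiag_two_iff L w _).2 (archPlaneLift_unitary (Circle.norm_coe z) hr)

/-- The lift `S¹ × M₂(ℝ) → U(σ_w Φ₂)(ℂ)` into the place carrier (junk value `1` off `det r = 1`). [cite: Borel1997, §4.1 (1)–(3)] -/
def archPlaneLiftLocal (p : Circle × Matrix (Fin 2) (Fin 2) ℝ) :
    ↥(archLocal L 2 (Matrix.of fun i j : Fin 2 => if i.val + j.val + 1 = 2 then (1 : L) else 0) w) :=
  if h : p ∈ {q : Circle × Matrix (Fin 2) (Fin 2) ℝ | q.2.det = 1} then ⟨archPlaneLiftGL p.1 p.2 h, archPlaneLiftGL_mem L w p.1 p.2 h⟩ else 1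

/-- On `det r = 1` the underlying matrix of the lift is `archPlaneLift z r`. [cite: Borel1997, §4.1 (1)–(3)] -/
theorem coe_archPlaneLiftLocal {p : Circle × Matrix (Fin 2) (Fin 2) ℝ} (hp : p.2.det = 1) :
    (((archPlaneLiftLocal L w p : ↥(archLocal L 2 (Matrix.of fun i j : Fin 2 => if i.val + j.val + 1 = 2 then (1 : L) else 0) w)) :
        GL (Fin 2) ℂ) : Matrix (Fin 2) (Fin 2) ℂ) = archPlaneLift (p.1 : ℂ) p.2 := by
  have h : p ∈ {q : Circle × Matrix (Fin 2) (Fin 2) ℝ | q.2.det = 1} := hp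
  simp only [archPlaneLiftLocal, dif_pos h]
  rfl

/-- The lift `(z, r) ↦ archPlaneLift z r`, as a map `ℂ × M₂(ℝ) → M₂(ℂ)`, is continuous. [cite: Borel1997, §4.1 (1)–(3)] -/
theorem continuous_archPlaneLift_uncurry' : Continuous fun p : ℂ × Matrix (Fin 2) (Fin 2) ℝ => archPlaneLift p.1 p.2 := by
  have h : ∀ a b : Fin 2, Continuous fun r : Matrix (Fin 2) (Fin 2) ℝ => ((r a b : ℝ) : ℂ) :=
    fun a b => Complex.continuous_ofReal.comp ((continuous_apply b).comp (continuous_apply a))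
  have hM : Continuous fun r : Matrix (Fin 2) (Fin 2) ℝ => !![(r 0 0 : ℂ), -I * r 0 1; I * r 1 0, r 1 1] := by
    refine continuous_matrix fun i j => ?_
    fin_cases i <;> fin_cases j
    · show Continuous fun r : Matrix (Fin 2) (Fin 2) ℝ => ((r 0 0 : ℝ) : ℂ)
      exact h 0 0
    · show Continuous fun r : Matrix (Fin 2) (Fin 2) ℝ => -I * ((r 0 1 : ℝ) : ℂ)
      exact continuous_const.mul (h 0 1)
    · show Continuous fun r : Matrix (Fin 2) (Fin 2) ℝ => I * ((r 1 0 : ℝ) : ℂ)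
      exact continuous_const.mul (h 1 0)
    · show Continuous fun r : Matrix (Fin 2) (Fin 2) ℝ => ((r 1 1 : ℝ) : ℂ)
      exact h 1 1
  unfold archPlaneLift
  exact continuous_fst.smul (hM.comp continuous_snd)

variable [MeasurableSpace (Matrix (Fin 2) (Fin 2) ℝ)] [BorelSpace (Matrix (Fin 2) (Fin 2) ℝ)] [MeasurableSpace Circle] [BorelSpace Circle]
  [MeasurableSpace ↥(archLocal L 2 (Matrix.of fun i j : Fin 2 => if i.val + j.val + 1 = 2 then (1 : L) else 0) w)]
  [BorelSpace ↥(archLocal L 2 (Matrix.of fun i j : Fin 2 => if i.val + j.val + 1 = 2 then (1 : L) else 0) w)]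

/-- The lift into the place carrier is measurable (continuous on the closed set `det r = 1` — both the matrix and its inverse `Φ₂ ȳᵀ Φ₂` depend continuously on
`(z, r)` — and constant off it). [cite: Borel1997, §4.1 (1)–(3)] -/
theorem measurable_archPlaneLiftLocal : Measurable (archPlaneLiftLocal L w) := by
  have hA : MeasurableSet {q : Circle × Matrix (Fin 2) (Fin 2) ℝ | q.2.det = 1} :=
    (isClosed_eq (continuous_snd.matrix_det) continuous_const).measurableSet
  unfold archPlaneLiftLocal
  refine Measurable.dite (s := {q : Circle × Matrix (Fin 2) (Fin 2) ℝ | q.2.det = 1})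
    (f := fun q : {q : Circle × Matrix (Fin 2) (Fin 2) ℝ // q ∈ {q : Circle × Matrix (Fin 2) (Fin 2) ℝ | q.2.det = 1}} =>
      (⟨archPlaneLiftGL q.1.1 q.1.2 q.2, archPlaneLiftGL_mem L w q.1.1 q.1.2 q.2⟩ :
        ↥(archLocal L 2 (Matrix.of fun i j : Fin 2 => if i.val + j.val + 1 = 2 then (1 : L) else 0) w)))
    (g := fun _ => 1) ?_ measurable_const hA
  refine Continuous.measurable ?_
  refine Continuous.subtype_mk ?_ _
  refine Units.continuous_iff.2 ⟨?_, ?_⟩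
  · show Continuous fun q : {q : Circle × Matrix (Fin 2) (Fin 2) ℝ // q ∈ {q : Circle × Matrix (Fin 2) (Fin 2) ℝ | q.2.det = 1}} =>
        archPlaneLift (q.1.1 : ℂ) q.1.2
    exact continuous_archPlaneLift_uncurry'.comp
      (((continuous_subtype_val.comp continuous_fst).prodMk continuous_snd).comp continuous_subtype_val)
  · show Continuous fun q : {q : Circle × Matrix (Fin 2) (Fin 2) ℝ // q ∈ {q : Circle × Matrix (Fin 2) (Fin 2) ℝ | q.2.det = 1}} =>
        archPlaneLift (conj (q.1.1 : ℂ)) q.1.2.adjugate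
    exact continuous_archPlaneLift_uncurry'.comp
      (((Complex.continuous_conj.comp (continuous_subtype_val.comp continuous_fst)).prodMk
        (continuous_snd.matrix_adjugate)).comp continuous_subtype_val)

omit [BorelSpace Circle]
  [MeasurableSpace ↥(archLocal L 2 (Matrix.of fun i j : Fin 2 => if i.val + j.val + 1 = 2 then (1 : L) else 0) w)]
  [BorelSpace ↥(archLocal L 2 (Matrix.of fun i j : Fin 2 => if i.val + j.val + 1 = 2 then (1 : L) else 0) w)] in
/-- `det r = 1` holds `μ ⊗ iwasawaMeasure`-almost everywhere (★ `iwasawaMeasure_compl_det_one`). [cite: Borel1997, §2.3] -/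
theorem ae_det_eq_one (μ : Measure Circle) [SFinite μ] :
    ∀ᵐ p ∂(μ.prod iwasawaMeasure), p.2.det = 1 := by
  haveI : SFinite (iwasawaMeasure : Measure (Matrix (Fin 2) (Fin 2) ℝ)) := by
    unfold iwasawaMeasure; infer_instance
  rw [ae_iff]
  refine measure_mono_null (t := (Set.univ : Set Circle) ×ˢ {r : Matrix (Fin 2) (Fin 2) ℝ | r.det = 1}ᶜ) (fun p hp => ⟨Set.mem_univ _, hp⟩) ?_
  rw [Measure.prod_prod, iwasawaMeasure_compl_det_one, mul_zero]

omit [MeasurableSpace Circle] [BorelSpace Circle] in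
/-- **«(T2-out)» — EVERY HAAR MEASURE OF `U(Φ₂)(ℂ)_w` HAS LINEAR HILBERT–SCHMIDT BALL GROWTH, GIVEN IT FOR `SL₂(ℝ)`.**  Inputs (hypothesis-shaped, LH3-p04's
(VOL-grp-SL2)): `iwasawaMeasure {r ∣ Σ r_ij² ≤ ρ} ≤ C ρ` for `ρ ≥ 2`, and `iwasawaMeasure ≠ 0`.  Conclusion: for every Haar measure `ν` on the place carrier
`archLocal L 2 Φ₂ w`, `ν {g ∣ Σ |g_ij|² ≤ ρ} ≤ C_ν ρ` for `ρ ≥ 2`.  Proof: the push-forward `ν₀` of `μ_{S¹} ⊗ iwasawaMeasure` along the lift is left invariant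
(surjectivity ★ `exists_archPlaneLift_eq_of_unitary`, multiplicativity ★ `archPlaneLift_mul`, ★ `map_mul_left_iwasawaMeasure`), finite on compacts (its HS-balls
have mass `μ(S¹) · iwasawaMeasure {Σ r² ≤ ρ}` by ★ `hs_archPlaneLift`) and non-zero, so by uniqueness of Haar measure `ν₀ = c • ν` with `c > 0`.
[cite: BeuzartPlessis2020Asterisque, §1.5 (1.5.2)–(1.5.3) p. 31] [cite: Borel1997, §4.1 (1)–(3); §2.3] -/
theorem haar_archLocal_two_hsBall_le
    (hSL : ∃ C : ℝ, ∀ ρ : ℝ, 2 ≤ ρ →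
      iwasawaMeasure {r : Matrix (Fin 2) (Fin 2) ℝ | ∑ i : Fin 2, ∑ j : Fin 2, r i j ^ 2 ≤ ρ} ≤ ENNReal.ofReal (C * ρ))
    (hSL0 : (iwasawaMeasure : Measure (Matrix (Fin 2) (Fin 2) ℝ)) ≠ 0)
    (ν : Measure ↥(archLocal L 2 (Matrix.of fun i j : Fin 2 => if i.val + j.val + 1 = 2 then (1 : L) else 0) w)) [ν.IsHaarMeasure] :
    ∃ C : ℝ, ∀ ρ : ℝ, 2 ≤ ρ →
      ν {g | ∑ i : Fin 2, ∑ j : Fin 2, ‖((g : GL (Fin 2) ℂ) : Matrix (Fin 2) (Fin 2) ℂ) i j‖ ^ 2 ≤ ρ} ≤ ENNReal.ofReal (C * ρ) := by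
  letI : MeasurableSpace Circle := borel Circle
  haveI : BorelSpace Circle := ⟨rfl⟩
  haveI : SFinite (iwasawaMeasure : Measure (Matrix (Fin 2) (Fin 2) ℝ)) := by
    unfold iwasawaMeasure; infer_instance
  haveI := locallyCompactSpace_archLocal L 2 (Matrix.of fun i j : Fin 2 => if i.val + j.val + 1 = 2 then (1 : L) else 0) w
  haveI := secondCountableTopology_archLocal L 2 (Matrix.of fun i j : Fin 2 => if i.val + j.val + 1 = 2 then (1 : L) else 0) w
  obtain ⟨C, hC⟩ := hSL
  -- the Haar probability of `S¹` and the product measure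
  set μ : Measure Circle := Measure.haar with hμ
  set m : Measure (Circle × Matrix (Fin 2) (Fin 2) ℝ) := μ.prod iwasawaMeasure with hm
  set ν₀ : Measure ↥(archLocal L 2 (Matrix.of fun i j : Fin 2 => if i.val + j.val + 1 = 2 then (1 : L) else 0) w) :=
    Measure.map (archPlaneLiftLocal L w) m with hν₀
  have hμfin : μ Set.univ < ⊤ := IsCompact.measure_lt_top isCompact_univ
  -- HS-balls are closed
  have hHS : Continuous fun g : ↥(archLocal L 2 (Matrix.of fun i j : Fin 2 => if i.val + j.val + 1 = 2 then (1 : L) else 0) w) =>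
      ∑ i : Fin 2, ∑ j : Fin 2, ‖((g : GL (Fin 2) ℂ) : Matrix (Fin 2) (Fin 2) ℂ) i j‖ ^ 2 := by
    have hv : Continuous fun g : ↥(archLocal L 2 (Matrix.of fun i j : Fin 2 => if i.val + j.val + 1 = 2 then (1 : L) else 0) w) =>
        ((g : GL (Fin 2) ℂ) : Matrix (Fin 2) (Fin 2) ℂ) := Units.continuous_val.comp continuous_subtype_val
    exact continuous_finsetSum _ fun i _ => continuous_finsetSum _ fun j _ => (((continuous_apply j).comp (continuous_apply i)).comp hv).norm.pow 2
  have hBmeas : ∀ ρ : ℝ, MeasurableSet {g : ↥(archLocal L 2 (Matrix.of fun i j : Fin 2 => if i.val + j.val + 1 = 2 then (1 : L) else 0) w) |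
      ∑ i : Fin 2, ∑ j : Fin 2, ‖((g : GL (Fin 2) ℂ) : Matrix (Fin 2) (Fin 2) ℂ) i j‖ ^ 2 ≤ ρ} :=
    fun ρ => (isClosed_le hHS continuous_const).measurableSet
  -- (1) the HS-balls of `ν₀`: preimage ⊆ `S¹ × {Σ r² ≤ ρ}` up to the null set `det r ≠ 1`
  have hball : ∀ ρ : ℝ, ν₀ {g | ∑ i : Fin 2, ∑ j : Fin 2, ‖((g : GL (Fin 2) ℂ) : Matrix (Fin 2) (Fin 2) ℂ) i j‖ ^ 2 ≤ ρ} ≤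
      μ Set.univ * iwasawaMeasure {r : Matrix (Fin 2) (Fin 2) ℝ | ∑ i : Fin 2, ∑ j : Fin 2, r i j ^ 2 ≤ ρ} := by
    intro ρ
    rw [hν₀, Measure.map_apply (measurable_archPlaneLiftLocal L w) (hBmeas ρ)]
    calc m (archPlaneLiftLocal L w ⁻¹' {g | ∑ i : Fin 2, ∑ j : Fin 2, ‖((g : GL (Fin 2) ℂ) : Matrix (Fin 2) (Fin 2) ℂ) i j‖ ^ 2 ≤ ρ})
        ≤ m (((Set.univ : Set Circle) ×ˢ {r : Matrix (Fin 2) (Fin 2) ℝ | ∑ i : Fin 2, ∑ j : Fin 2, r i j ^ 2 ≤ ρ}) ∪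
            ((Set.univ : Set Circle) ×ˢ {r : Matrix (Fin 2) (Fin 2) ℝ | r.det = 1}ᶜ)) := by
          refine measure_mono fun p hp => ?_
          by_cases hdet : p.2.det = 1
          · left
            refine ⟨Set.mem_univ _, ?_⟩
            simp only [Set.mem_preimage, Set.mem_setOf_eq] at hp
            rw [coe_archPlaneLiftLocal L w hdet, hs_archPlaneLift (Circle.norm_coe p.1)] at hp
            exact hp
          · right
            exact ⟨Set.mem_univ _, hdet⟩
      _ ≤ m ((Set.univ : Set Circle) ×ˢ {r : Matrix (Fin 2) (Fin 2) ℝ | ∑ i : Fin 2, ∑ j : Fin 2, r i j ^ 2 ≤ ρ}) +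
            m ((Set.univ : Set Circle) ×ˢ {r : Matrix (Fin 2) (Fin 2) ℝ | r.det = 1}ᶜ) := measure_union_le _ _
      _ = μ Set.univ * iwasawaMeasure {r : Matrix (Fin 2) (Fin 2) ℝ | ∑ i : Fin 2, ∑ j : Fin 2, r i j ^ 2 ≤ ρ} := by
          rw [hm, Measure.prod_prod, Measure.prod_prod, iwasawaMeasure_compl_det_one, mul_zero, add_zero]
  -- (2) `ν₀` is left invariant
  haveI hinv : ν₀.IsMulLeftInvariant := by
    refine ⟨fun x => ?_⟩
    -- `x = lift (z₀, r₀)`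
    obtain ⟨z₀, r₀, hz₀, hr₀, hx⟩ := exists_archPlaneLift_eq_of_unitary ((mem_archLocal_antidiag_two_iff L w _).1 x.2)
    let ζ₀ : Circle := ⟨z₀, mem_sphere_zero_iff_norm.2 hz₀⟩
    have hmulx : Measurable fun g : ↥(archLocal L 2 (Matrix.of fun i j : Fin 2 => if i.val + j.val + 1 = 2 then (1 : L) else 0) w) => x * g :=
      (continuous_const.mul continuous_id).measurable
    have hT : Measurable fun p : Circle × Matrix (Fin 2) (Fin 2) ℝ => (ζ₀ * p.1, r₀ * p.2) :=
      ((continuous_const.mul continuous_fst).prodMk ((continuous_const.matrix_mul continuous_id).comp continuous_snd)).measurable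
    rw [hν₀, Measure.map_map hmulx (measurable_archPlaneLiftLocal L w)]
    -- a.e. `x * lift p = lift (ζ₀ z, r₀ r)`
    have hae : (fun g : ↥(archLocal L 2 (Matrix.of fun i j : Fin 2 => if i.val + j.val + 1 = 2 then (1 : L) else 0) w) => x * g) ∘
        archPlaneLiftLocal L w =ᵐ[m] archPlaneLiftLocal L w ∘ fun p => (ζ₀ * p.1, r₀ * p.2) := by
      filter_upwards [ae_det_eq_one μ] with p hp
      have hp' : (r₀ * p.2).det = 1 := by rw [Matrix.det_mul, hr₀, hp, one_mul]
      apply Subtype.ext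
      apply Units.ext
      simp only [Function.comp_apply, Subgroup.coe_mul, Units.val_mul]
      rw [coe_archPlaneLiftLocal L w hp, coe_archPlaneLiftLocal L w (p := (ζ₀ * p.1, r₀ * p.2)) hp', hx, Circle.coe_mul,
        archPlaneLift_mul]
    rw [Measure.map_congr hae, ← Measure.map_map (measurable_archPlaneLiftLocal L w) hT]
    congr 1
    have hprod : (fun p : Circle × Matrix (Fin 2) (Fin 2) ℝ => (ζ₀ * p.1, r₀ * p.2)) = Prod.map (fun z => ζ₀ * z) fun g => r₀ * g := rfl
    rw [hm, hprod, ← Measure.map_prod_map _ _ (measurable_const_mul ζ₀) (measurable_mul_left r₀), map_mul_left_eq_self,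
      map_mul_left_iwasawaMeasure ⟨r₀, hr₀⟩]
  -- (3) `ν₀` is finite on compacts (a compact set lies in an HS-ball)
  haveI hfin : IsFiniteMeasureOnCompacts ν₀ := by
    refine ⟨fun K hK => ?_⟩
    obtain ⟨R, hR⟩ := hK.bddAbove_image hHS.continuousOn
    have hsub : K ⊆ {g | ∑ i : Fin 2, ∑ j : Fin 2, ‖((g : GL (Fin 2) ℂ) : Matrix (Fin 2) (Fin 2) ℂ) i j‖ ^ 2 ≤ max R 2} :=
      fun g hg => (hR ⟨g, hg, rfl⟩).trans (le_max_left _ _)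
    calc ν₀ K ≤ ν₀ {g | ∑ i : Fin 2, ∑ j : Fin 2, ‖((g : GL (Fin 2) ℂ) : Matrix (Fin 2) (Fin 2) ℂ) i j‖ ^ 2 ≤ max R 2} := measure_mono hsub
      _ ≤ μ Set.univ * iwasawaMeasure {r : Matrix (Fin 2) (Fin 2) ℝ | ∑ i : Fin 2, ∑ j : Fin 2, r i j ^ 2 ≤ max R 2} := hball _
      _ ≤ μ Set.univ * ENNReal.ofReal (C * max R 2) := by gcongr; exact hC _ (le_max_right _ _)
      _ < ⊤ := ENNReal.mul_lt_top hμfin ENNReal.ofReal_lt_top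
  -- (4) uniqueness of Haar measure: `ν₀ = c • ν` with `c ≠ 0`
  have hν₀ν : ν₀ = ν₀.haarScalarFactor ν • ν := Measure.isMulLeftInvariant_eq_smul ν₀ ν
  set c : ℝ≥0 := ν₀.haarScalarFactor ν with hc
  have hμ0 : μ Set.univ ≠ 0 := (isOpen_univ.measure_pos μ Set.univ_nonempty).ne'
  have hν₀univ : ν₀ Set.univ = μ Set.univ * iwasawaMeasure Set.univ := by
    rw [hν₀, Measure.map_apply (measurable_archPlaneLiftLocal L w) MeasurableSet.univ, Set.preimage_univ, hm,
      ← Set.univ_prod_univ, Measure.prod_prod]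
  have hc0 : c ≠ 0 := by
    intro h0
    have h1 : ν₀ Set.univ = 0 := by
      rw [hν₀ν, h0, zero_smul, Measure.coe_zero, Pi.zero_apply]
    rw [hν₀univ] at h1
    rcases mul_eq_zero.mp h1 with h2 | h2
    · exact hμ0 h2
    · exact hSL0 (Measure.measure_univ_eq_zero.mp h2)
  have hc0' : ((c : ℝ≥0) : ℝ≥0∞) ≠ 0 := by exact_mod_cast hc0
  have hKfin : ((c : ℝ≥0) : ℝ≥0∞)⁻¹ * μ Set.univ < ⊤ :=
    ENNReal.mul_lt_top (ENNReal.inv_lt_top.mpr (pos_iff_ne_zero.mpr hc0')) hμfin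
  refine ⟨((((c : ℝ≥0) : ℝ≥0∞)⁻¹ * μ Set.univ).toReal) * C, fun ρ hρ => ?_⟩
  have h1 : ν₀ {g | ∑ i : Fin 2, ∑ j : Fin 2, ‖((g : GL (Fin 2) ℂ) : Matrix (Fin 2) (Fin 2) ℂ) i j‖ ^ 2 ≤ ρ} =
      ((c : ℝ≥0) : ℝ≥0∞) * ν {g | ∑ i : Fin 2, ∑ j : Fin 2, ‖((g : GL (Fin 2) ℂ) : Matrix (Fin 2) (Fin 2) ℂ) i j‖ ^ 2 ≤ ρ} := by
    conv_lhs => rw [hν₀ν]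
    rw [Measure.smul_apply, ENNReal.smul_def, smul_eq_mul]
  have key : ν {g | ∑ i : Fin 2, ∑ j : Fin 2, ‖((g : GL (Fin 2) ℂ) : Matrix (Fin 2) (Fin 2) ℂ) i j‖ ^ 2 ≤ ρ} =
      ((c : ℝ≥0) : ℝ≥0∞)⁻¹ * ν₀ {g | ∑ i : Fin 2, ∑ j : Fin 2, ‖((g : GL (Fin 2) ℂ) : Matrix (Fin 2) (Fin 2) ℂ) i j‖ ^ 2 ≤ ρ} := by
    rw [h1, ← mul_assoc, ENNReal.inv_mul_cancel hc0' ENNReal.coe_ne_top, one_mul]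
  calc ν {g | ∑ i : Fin 2, ∑ j : Fin 2, ‖((g : GL (Fin 2) ℂ) : Matrix (Fin 2) (Fin 2) ℂ) i j‖ ^ 2 ≤ ρ}
      = ((c : ℝ≥0) : ℝ≥0∞)⁻¹ * ν₀ {g | ∑ i : Fin 2, ∑ j : Fin 2, ‖((g : GL (Fin 2) ℂ) : Matrix (Fin 2) (Fin 2) ℂ) i j‖ ^ 2 ≤ ρ} := key
    _ ≤ ((c : ℝ≥0) : ℝ≥0∞)⁻¹ *
          (μ Set.univ * iwasawaMeasure {r : Matrix (Fin 2) (Fin 2) ℝ | ∑ i : Fin 2, ∑ j : Fin 2, r i j ^ 2 ≤ ρ}) := by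
        gcongr; exact hball ρ
    _ ≤ ((c : ℝ≥0) : ℝ≥0∞)⁻¹ * (μ Set.univ * ENNReal.ofReal (C * ρ)) := by
        gcongr; exact hC ρ hρ
    _ = ENNReal.ofReal ((((c : ℝ≥0) : ℝ≥0∞)⁻¹ * μ Set.univ).toReal * C * ρ) := by
        rw [← mul_assoc, mul_assoc ((((c : ℝ≥0) : ℝ≥0∞)⁻¹ * μ Set.univ).toReal) C ρ,
          ENNReal.ofReal_mul ENNReal.toReal_nonneg, ENNReal.ofReal_toReal hKfin.ne]

end Subtype


/-! ## §3 (ED. 2) The two `SL₂(ℝ)` inputs discharged (★ `SL2HSBallVolume`, ★ `SL2CoordSetIntegral`): «(T2-out)» UNCONDITIONAL -/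

section Inputs

variable [MeasurableSpace (Matrix (Fin 2) (Fin 2) ℝ)] [BorelSpace (Matrix (Fin 2) (Fin 2) ℝ)]

omit [BorelSpace (Matrix (Fin 2) (Fin 2) ℝ)] in
/-- `iwasawaMeasure ≤ haarSL2pm` setwise (★ `haarSL2pm = iwasawaMeasure + σ_* iwasawaMeasure`). [cite: Borel1997, §2.3] -/
theorem iwasawaMeasure_le_haarSL2pm (s : Set (Matrix (Fin 2) (Fin 2) ℝ)) : iwasawaMeasure s ≤ haarSL2pm s := by
  rw [haarSL2pm, Measure.add_apply]
  exact le_self_add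

/-- **Linear HS-ball growth for `iwasawaMeasure`** (from LH3-p04's ★ `exists_haarSL2pm_hsBall_le_linear`, `C = 16π`).
[cite: BeuzartPlessis2020Asterisque, §1.5 (1.5.2)–(1.5.3) p. 31] -/
theorem exists_iwasawaMeasure_hsBall_le_linear :
    ∃ C : ℝ, ∀ ρ : ℝ, 2 ≤ ρ →
      iwasawaMeasure {r : Matrix (Fin 2) (Fin 2) ℝ | ∑ i : Fin 2, ∑ j : Fin 2, r i j ^ 2 ≤ ρ} ≤ ENNReal.ofReal (C * ρ) := by
  obtain ⟨C, hC⟩ := exists_haarSL2pm_hsBall_le_linear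
  exact ⟨C, fun ρ hρ => (iwasawaMeasure_le_haarSL2pm _).trans (hC ρ hρ)⟩

omit [MeasurableSpace (Matrix (Fin 2) (Fin 2) ℝ)] [BorelSpace (Matrix (Fin 2) (Fin 2) ℝ)] in
/-- The hyperbolic plane has non-zero (indeed infinite) volume: the strip `{|x| ≤ ½, y > 1}` already has area `1` (★ `volume_coe_preimage`, ★ `lintegral_stripAbove`).
[cite: Borel1997, §2.3] -/
theorem volume_upperHalfPlane_univ_ne_zero : (volume : Measure UpperHalfPlane) Set.univ ≠ 0 := by
  intro h0
  have h1 : (volume : Measure UpperHalfPlane) (((↑) : UpperHalfPlane → ℂ) ⁻¹' stripAbove 1) = ENNReal.ofReal (1 / 1) := by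
    rw [volume_coe_preimage (measurableSet_stripAbove 1) (stripAbove_subset zero_le_one), lintegral_stripAbove one_pos]
  have h2 : (volume : Measure UpperHalfPlane) (((↑) : UpperHalfPlane → ℂ) ⁻¹' stripAbove 1) ≤ (volume : Measure UpperHalfPlane) Set.univ :=
    measure_mono (Set.subset_univ _)
  rw [h0, h1] at h2
  simp at h2

/-- **`iwasawaMeasure ≠ 0`**: its total mass is `vol_ℍ(ℍ) · 2π`. [cite: Borel1997, §2.3] -/
theorem iwasawaMeasure_ne_zero : (iwasawaMeasure : Measure (Matrix (Fin 2) (Fin 2) ℝ)) ≠ 0 := by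
  haveI : Fact (0 < 2 * Real.pi) := fact_two_pi_pos
  intro h0
  have h1 : (iwasawaMeasure : Measure (Matrix (Fin 2) (Fin 2) ℝ)) Set.univ = 0 := by rw [h0, Measure.coe_zero, Pi.zero_apply]
  rw [iwasawaMeasure_apply MeasurableSet.univ, Set.preimage_univ, ← Set.univ_prod_univ, Measure.prod_prod, AddCircle.measure_univ,
    mul_eq_zero] at h1
  rcases h1 with h | h
  · exact volume_upperHalfPlane_univ_ne_zero h
  · have : (0 : ℝ) < 2 * Real.pi := Real.two_pi_pos
    rw [ENNReal.ofReal_eq_zero] at h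
    linarith

end Inputs

/-! ## §4 (ED. 2) «(T2-out)» unconditional -/

section Unconditional

open NumberField NumberField.InfinitePlace Literature.NumberTheory.Automorphic Literature.NumberTheory.Automorphic.UnitaryGroup

/-- **«(T2-out)», UNCONDITIONAL — EVERY HAAR MEASURE OF THE PLACE CARRIER `U(Φ₂)(ℂ)_w ≅ U(1,1)` HAS LINEAR HILBERT–SCHMIDT BALL GROWTH**: for every field `L`,
complex place `w` and Haar measure `ν` on `archLocal L 2 Φ₂ w` (any Borel structure), `∃ C, ∀ ρ ≥ 2, ν {g ∣ Σ |g_ij|² ≤ ρ} ≤ C ρ` (§2 with the inputs of §3;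
the auxiliary Borel structure on `M₂(ℝ)` is chosen inside the proof). [cite: BeuzartPlessis2020Asterisque, §1.5 (1.5.2)–(1.5.3) p. 31] [cite: Borel1997, §2.3; §4.1 (1)–(3)] -/
theorem haar_archLocal_two_hsBall_le_linear (L : Type) [Field L] (w : {w : InfinitePlace L // w.IsComplex})
    [MeasurableSpace ↥(archLocal L 2 (Matrix.of fun i j : Fin 2 => if i.val + j.val + 1 = 2 then (1 : L) else 0) w)]
    [BorelSpace ↥(archLocal L 2 (Matrix.of fun i j : Fin 2 => if i.val + j.val + 1 = 2 then (1 : L) else 0) w)]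
    (ν : Measure ↥(archLocal L 2 (Matrix.of fun i j : Fin 2 => if i.val + j.val + 1 = 2 then (1 : L) else 0) w)) [ν.IsHaarMeasure] :
    ∃ C : ℝ, ∀ ρ : ℝ, 2 ≤ ρ →
      ν {g | ∑ i : Fin 2, ∑ j : Fin 2, ‖((g : GL (Fin 2) ℂ) : Matrix (Fin 2) (Fin 2) ℂ) i j‖ ^ 2 ≤ ρ} ≤ ENNReal.ofReal (C * ρ) := by
  letI : MeasurableSpace (Matrix (Fin 2) (Fin 2) ℝ) := borel _
  haveI : BorelSpace (Matrix (Fin 2) (Fin 2) ℝ) := ⟨rfl⟩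
  exact haar_archLocal_two_hsBall_le L w exists_iwasawaMeasure_hsBall_le_linear iwasawaMeasure_ne_zero ν

end Unconditional

section UnitaryCarrier

open NumberField NumberField.InfinitePlace Literature.NumberTheory.Automorphic Literature.NumberTheory.Automorphic.UnitaryGroup


/-- The lift lands in the place carrier `U(σ_w Φ₂)(ℂ)` (★ `archPlaneLift_unitary`). [cite: Rogawski1990, §3.1 p. 19] [cite: Borel1997, §4.1 (1)–(3)] -/
theorem archPlaneLiftGL_mem_unitaryGroupOfForm (z : Circle) (r : Matrix (Fin 2) (Fin 2) ℝ) (hr : r.det = 1) :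
    archPlaneLiftGL z r hr ∈ unitaryGroupOfForm (starRingEnd ℂ) (Matrix.of fun i j : Fin 2 => if i.val + j.val + 1 = 2 then (1 : ℂ) else 0) :=
  archPlaneLift_unitary (Circle.norm_coe z) hr

/-- The lift `S¹ × M₂(ℝ) → U(σ_w Φ₂)(ℂ)` into the place carrier (junk value `1` off `det r = 1`). [cite: Borel1997, §4.1 (1)–(3)] -/
def archPlaneLiftUnitary (p : Circle × Matrix (Fin 2) (Fin 2) ℝ) :
    ↥(unitaryGroupOfForm (starRingEnd ℂ) (Matrix.of fun i j : Fin 2 => if i.val + j.val + 1 = 2 then (1 : ℂ) else 0)) :=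
  if h : p ∈ {q : Circle × Matrix (Fin 2) (Fin 2) ℝ | q.2.det = 1} then ⟨archPlaneLiftGL p.1 p.2 h, archPlaneLiftGL_mem_unitaryGroupOfForm p.1 p.2 h⟩ else 1

/-- On `det r = 1` the underlying matrix of the lift is `archPlaneLift z r`. [cite: Borel1997, §4.1 (1)–(3)] -/
theorem coe_archPlaneLiftUnitary {p : Circle × Matrix (Fin 2) (Fin 2) ℝ} (hp : p.2.det = 1) :
    (((archPlaneLiftUnitary p : ↥(unitaryGroupOfForm (starRingEnd ℂ) (Matrix.of fun i j : Fin 2 => if i.val + j.val + 1 = 2 then (1 : ℂ) else 0))) :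
        GL (Fin 2) ℂ) : Matrix (Fin 2) (Fin 2) ℂ) = archPlaneLift (p.1 : ℂ) p.2 := by
  have h : p ∈ {q : Circle × Matrix (Fin 2) (Fin 2) ℝ | q.2.det = 1} := hp
  simp only [archPlaneLiftUnitary, dif_pos h]
  rfl

variable [MeasurableSpace (Matrix (Fin 2) (Fin 2) ℝ)] [BorelSpace (Matrix (Fin 2) (Fin 2) ℝ)] [MeasurableSpace Circle] [BorelSpace Circle]
  [MeasurableSpace ↥(unitaryGroupOfForm (starRingEnd ℂ) (Matrix.of fun i j : Fin 2 => if i.val + j.val + 1 = 2 then (1 : ℂ) else 0))]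
  [BorelSpace ↥(unitaryGroupOfForm (starRingEnd ℂ) (Matrix.of fun i j : Fin 2 => if i.val + j.val + 1 = 2 then (1 : ℂ) else 0))]

/-- The lift into the place carrier is measurable (continuous on the closed set `det r = 1` — both the matrix and its inverse `Φ₂ ȳᵀ Φ₂` depend continuously on
`(z, r)` — and constant off it). [cite: Borel1997, §4.1 (1)–(3)] -/
theorem measurable_archPlaneLiftUnitary : Measurable (archPlaneLiftUnitary) := by
  have hA : MeasurableSet {q : Circle × Matrix (Fin 2) (Fin 2) ℝ | q.2.det = 1} :=
    (isClosed_eq (continuous_snd.matrix_det) continuous_const).measurableSet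
  unfold archPlaneLiftUnitary
  refine Measurable.dite (s := {q : Circle × Matrix (Fin 2) (Fin 2) ℝ | q.2.det = 1})
    (f := fun q : {q : Circle × Matrix (Fin 2) (Fin 2) ℝ // q ∈ {q : Circle × Matrix (Fin 2) (Fin 2) ℝ | q.2.det = 1}} =>
      (⟨archPlaneLiftGL q.1.1 q.1.2 q.2, archPlaneLiftGL_mem_unitaryGroupOfForm q.1.1 q.1.2 q.2⟩ :
        ↥(unitaryGroupOfForm (starRingEnd ℂ) (Matrix.of fun i j : Fin 2 => if i.val + j.val + 1 = 2 then (1 : ℂ) else 0))))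
    (g := fun _ => 1) ?_ measurable_const hA
  refine Continuous.measurable ?_
  refine Continuous.subtype_mk ?_ _
  refine Units.continuous_iff.2 ⟨?_, ?_⟩
  · show Continuous fun q : {q : Circle × Matrix (Fin 2) (Fin 2) ℝ // q ∈ {q : Circle × Matrix (Fin 2) (Fin 2) ℝ | q.2.det = 1}} =>
        archPlaneLift (q.1.1 : ℂ) q.1.2
    exact continuous_archPlaneLift_uncurry'.comp
      (((continuous_subtype_val.comp continuous_fst).prodMk continuous_snd).comp continuous_subtype_val)
  · show Continuous fun q : {q : Circle × Matrix (Fin 2) (Fin 2) ℝ // q ∈ {q : Circle × Matrix (Fin 2) (Fin 2) ℝ | q.2.det = 1}} =>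
        archPlaneLift (conj (q.1.1 : ℂ)) q.1.2.adjugate
    exact continuous_archPlaneLift_uncurry'.comp
      (((Complex.continuous_conj.comp (continuous_subtype_val.comp continuous_fst)).prodMk
        (continuous_snd.matrix_adjugate)).comp continuous_subtype_val)

omit [MeasurableSpace Circle] [BorelSpace Circle] in
/-- **«(T2-out)» — EVERY HAAR MEASURE OF `U(Φ₂)(ℂ)_w` HAS LINEAR HILBERT–SCHMIDT BALL GROWTH, GIVEN IT FOR `SL₂(ℝ)`.**  Inputs (hypothesis-shaped, LH3-p04's
(VOL-grp-SL2)): `iwasawaMeasure {r ∣ Σ r_ij² ≤ ρ} ≤ C ρ` for `ρ ≥ 2`, and `iwasawaMeasure ≠ 0`.  Conclusion: for every Haar measure `ν` on the place carrier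
`archLocal L 2 Φ₂ w`, `ν {g ∣ Σ |g_ij|² ≤ ρ} ≤ C_ν ρ` for `ρ ≥ 2`.  Proof: the push-forward `ν₀` of `μ_{S¹} ⊗ iwasawaMeasure` along the lift is left invariant
(surjectivity ★ `exists_archPlaneLift_eq_of_unitary`, multiplicativity ★ `archPlaneLift_mul`, ★ `map_mul_left_iwasawaMeasure`), finite on compacts (its HS-balls
have mass `μ(S¹) · iwasawaMeasure {Σ r² ≤ ρ}` by ★ `hs_archPlaneLift`) and non-zero, so by uniqueness of Haar measure `ν₀ = c • ν` with `c > 0`.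
[cite: BeuzartPlessis2020Asterisque, §1.5 (1.5.2)–(1.5.3) p. 31] [cite: Borel1997, §4.1 (1)–(3); §2.3] -/
theorem haar_unitaryGroupOfForm_antidiag_two_hsBall_le
    (hSL : ∃ C : ℝ, ∀ ρ : ℝ, 2 ≤ ρ →
      iwasawaMeasure {r : Matrix (Fin 2) (Fin 2) ℝ | ∑ i : Fin 2, ∑ j : Fin 2, r i j ^ 2 ≤ ρ} ≤ ENNReal.ofReal (C * ρ))
    (hSL0 : (iwasawaMeasure : Measure (Matrix (Fin 2) (Fin 2) ℝ)) ≠ 0)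
    (ν : Measure ↥(unitaryGroupOfForm (starRingEnd ℂ) (Matrix.of fun i j : Fin 2 => if i.val + j.val + 1 = 2 then (1 : ℂ) else 0))) [ν.IsHaarMeasure] :
    ∃ C : ℝ, ∀ ρ : ℝ, 2 ≤ ρ →
      ν {g | ∑ i : Fin 2, ∑ j : Fin 2, ‖((g : GL (Fin 2) ℂ) : Matrix (Fin 2) (Fin 2) ℂ) i j‖ ^ 2 ≤ ρ} ≤ ENNReal.ofReal (C * ρ) := by
  letI : MeasurableSpace Circle := borel Circle
  haveI : BorelSpace Circle := ⟨rfl⟩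
  haveI : SFinite (iwasawaMeasure : Measure (Matrix (Fin 2) (Fin 2) ℝ)) := by
    unfold iwasawaMeasure; infer_instance
  haveI := locallyCompactSpace_unitaryGroupOfForm_complex (Matrix.of fun i j : Fin 2 => if i.val + j.val + 1 = 2 then (1 : ℂ) else 0)
  haveI := secondCountableTopology_unitaryGroupOfForm_complex (Matrix.of fun i j : Fin 2 => if i.val + j.val + 1 = 2 then (1 : ℂ) else 0)
  obtain ⟨C, hC⟩ := hSL
  -- the Haar probability of `S¹` and the product measure
  set μ : Measure Circle := Measure.haar with hμ
  set m : Measure (Circle × Matrix (Fin 2) (Fin 2) ℝ) := μ.prod iwasawaMeasure with hm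
  set ν₀ : Measure ↥(unitaryGroupOfForm (starRingEnd ℂ) (Matrix.of fun i j : Fin 2 => if i.val + j.val + 1 = 2 then (1 : ℂ) else 0)) :=
    Measure.map (archPlaneLiftUnitary) m with hν₀
  have hμfin : μ Set.univ < ⊤ := IsCompact.measure_lt_top isCompact_univ
  -- HS-balls are closed
  have hHS : Continuous fun g : ↥(unitaryGroupOfForm (starRingEnd ℂ) (Matrix.of fun i j : Fin 2 => if i.val + j.val + 1 = 2 then (1 : ℂ) else 0)) =>
      ∑ i : Fin 2, ∑ j : Fin 2, ‖((g : GL (Fin 2) ℂ) : Matrix (Fin 2) (Fin 2) ℂ) i j‖ ^ 2 := by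
    have hv : Continuous fun g : ↥(unitaryGroupOfForm (starRingEnd ℂ) (Matrix.of fun i j : Fin 2 => if i.val + j.val + 1 = 2 then (1 : ℂ) else 0)) =>
        ((g : GL (Fin 2) ℂ) : Matrix (Fin 2) (Fin 2) ℂ) := Units.continuous_val.comp continuous_subtype_val
    exact continuous_finsetSum _ fun i _ => continuous_finsetSum _ fun j _ => (((continuous_apply j).comp (continuous_apply i)).comp hv).norm.pow 2
  have hBmeas : ∀ ρ : ℝ, MeasurableSet {g : ↥(unitaryGroupOfForm (starRingEnd ℂ) (Matrix.of fun i j : Fin 2 => if i.val + j.val + 1 = 2 then (1 : ℂ) else 0)) |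
      ∑ i : Fin 2, ∑ j : Fin 2, ‖((g : GL (Fin 2) ℂ) : Matrix (Fin 2) (Fin 2) ℂ) i j‖ ^ 2 ≤ ρ} :=
    fun ρ => (isClosed_le hHS continuous_const).measurableSet
  -- (1) the HS-balls of `ν₀`: preimage ⊆ `S¹ × {Σ r² ≤ ρ}` up to the null set `det r ≠ 1`
  have hball : ∀ ρ : ℝ, ν₀ {g | ∑ i : Fin 2, ∑ j : Fin 2, ‖((g : GL (Fin 2) ℂ) : Matrix (Fin 2) (Fin 2) ℂ) i j‖ ^ 2 ≤ ρ} ≤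
      μ Set.univ * iwasawaMeasure {r : Matrix (Fin 2) (Fin 2) ℝ | ∑ i : Fin 2, ∑ j : Fin 2, r i j ^ 2 ≤ ρ} := by
    intro ρ
    rw [hν₀, Measure.map_apply (measurable_archPlaneLiftUnitary) (hBmeas ρ)]
    calc m (archPlaneLiftUnitary ⁻¹' {g | ∑ i : Fin 2, ∑ j : Fin 2, ‖((g : GL (Fin 2) ℂ) : Matrix (Fin 2) (Fin 2) ℂ) i j‖ ^ 2 ≤ ρ})
        ≤ m (((Set.univ : Set Circle) ×ˢ {r : Matrix (Fin 2) (Fin 2) ℝ | ∑ i : Fin 2, ∑ j : Fin 2, r i j ^ 2 ≤ ρ}) ∪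
            ((Set.univ : Set Circle) ×ˢ {r : Matrix (Fin 2) (Fin 2) ℝ | r.det = 1}ᶜ)) := by
          refine measure_mono fun p hp => ?_
          by_cases hdet : p.2.det = 1
          · left
            refine ⟨Set.mem_univ _, ?_⟩
            simp only [Set.mem_preimage, Set.mem_setOf_eq] at hp
            rw [coe_archPlaneLiftUnitary hdet, hs_archPlaneLift (Circle.norm_coe p.1)] at hp
            exact hp
          · right
            exact ⟨Set.mem_univ _, hdet⟩
      _ ≤ m ((Set.univ : Set Circle) ×ˢ {r : Matrix (Fin 2) (Fin 2) ℝ | ∑ i : Fin 2, ∑ j : Fin 2, r i j ^ 2 ≤ ρ}) +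
            m ((Set.univ : Set Circle) ×ˢ {r : Matrix (Fin 2) (Fin 2) ℝ | r.det = 1}ᶜ) := measure_union_le _ _
      _ = μ Set.univ * iwasawaMeasure {r : Matrix (Fin 2) (Fin 2) ℝ | ∑ i : Fin 2, ∑ j : Fin 2, r i j ^ 2 ≤ ρ} := by
          rw [hm, Measure.prod_prod, Measure.prod_prod, iwasawaMeasure_compl_det_one, mul_zero, add_zero]
  -- (2) `ν₀` is left invariant
  haveI hinv : ν₀.IsMulLeftInvariant := by
    refine ⟨fun x => ?_⟩
    -- `x = lift (z₀, r₀)`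
    obtain ⟨z₀, r₀, hz₀, hr₀, hx⟩ := exists_archPlaneLift_eq_of_unitary x.2
    let ζ₀ : Circle := ⟨z₀, mem_sphere_zero_iff_norm.2 hz₀⟩
    have hmulx : Measurable fun g : ↥(unitaryGroupOfForm (starRingEnd ℂ) (Matrix.of fun i j : Fin 2 => if i.val + j.val + 1 = 2 then (1 : ℂ) else 0)) => x * g :=
      (continuous_const.mul continuous_id).measurable
    have hT : Measurable fun p : Circle × Matrix (Fin 2) (Fin 2) ℝ => (ζ₀ * p.1, r₀ * p.2) :=
      ((continuous_const.mul continuous_fst).prodMk ((continuous_const.matrix_mul continuous_id).comp continuous_snd)).measurable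
    rw [hν₀, Measure.map_map hmulx (measurable_archPlaneLiftUnitary)]
    -- a.e. `x * lift p = lift (ζ₀ z, r₀ r)`
    have hae : (fun g : ↥(unitaryGroupOfForm (starRingEnd ℂ) (Matrix.of fun i j : Fin 2 => if i.val + j.val + 1 = 2 then (1 : ℂ) else 0)) => x * g) ∘
        archPlaneLiftUnitary =ᵐ[m] archPlaneLiftUnitary ∘ fun p => (ζ₀ * p.1, r₀ * p.2) := by
      filter_upwards [ae_det_eq_one μ] with p hp
      have hp' : (r₀ * p.2).det = 1 := by rw [Matrix.det_mul, hr₀, hp, one_mul]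
      apply Subtype.ext
      apply Units.ext
      simp only [Function.comp_apply, Subgroup.coe_mul, Units.val_mul]
      rw [coe_archPlaneLiftUnitary hp, coe_archPlaneLiftUnitary (p := (ζ₀ * p.1, r₀ * p.2)) hp', hx, Circle.coe_mul,
        archPlaneLift_mul]
    rw [Measure.map_congr hae, ← Measure.map_map (measurable_archPlaneLiftUnitary) hT]
    congr 1
    have hprod : (fun p : Circle × Matrix (Fin 2) (Fin 2) ℝ => (ζ₀ * p.1, r₀ * p.2)) = Prod.map (fun z => ζ₀ * z) fun g => r₀ * g := rfl
    rw [hm, hprod, ← Measure.map_prod_map _ _ (measurable_const_mul ζ₀) (measurable_mul_left r₀), map_mul_left_eq_self,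
      map_mul_left_iwasawaMeasure ⟨r₀, hr₀⟩]
  -- (3) `ν₀` is finite on compacts (a compact set lies in an HS-ball)
  haveI hfin : IsFiniteMeasureOnCompacts ν₀ := by
    refine ⟨fun K hK => ?_⟩
    obtain ⟨R, hR⟩ := hK.bddAbove_image hHS.continuousOn
    have hsub : K ⊆ {g | ∑ i : Fin 2, ∑ j : Fin 2, ‖((g : GL (Fin 2) ℂ) : Matrix (Fin 2) (Fin 2) ℂ) i j‖ ^ 2 ≤ max R 2} :=
      fun g hg => (hR ⟨g, hg, rfl⟩).trans (le_max_left _ _)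
    calc ν₀ K ≤ ν₀ {g | ∑ i : Fin 2, ∑ j : Fin 2, ‖((g : GL (Fin 2) ℂ) : Matrix (Fin 2) (Fin 2) ℂ) i j‖ ^ 2 ≤ max R 2} := measure_mono hsub
      _ ≤ μ Set.univ * iwasawaMeasure {r : Matrix (Fin 2) (Fin 2) ℝ | ∑ i : Fin 2, ∑ j : Fin 2, r i j ^ 2 ≤ max R 2} := hball _
      _ ≤ μ Set.univ * ENNReal.ofReal (C * max R 2) := by gcongr; exact hC _ (le_max_right _ _)
      _ < ⊤ := ENNReal.mul_lt_top hμfin ENNReal.ofReal_lt_top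
  -- (4) uniqueness of Haar measure: `ν₀ = c • ν` with `c ≠ 0`
  have hν₀ν : ν₀ = ν₀.haarScalarFactor ν • ν := Measure.isMulLeftInvariant_eq_smul ν₀ ν
  set c : ℝ≥0 := ν₀.haarScalarFactor ν with hc
  have hμ0 : μ Set.univ ≠ 0 := (isOpen_univ.measure_pos μ Set.univ_nonempty).ne'
  have hν₀univ : ν₀ Set.univ = μ Set.univ * iwasawaMeasure Set.univ := by
    rw [hν₀, Measure.map_apply (measurable_archPlaneLiftUnitary) MeasurableSet.univ, Set.preimage_univ, hm,
      ← Set.univ_prod_univ, Measure.prod_prod]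
  have hc0 : c ≠ 0 := by
    intro h0
    have h1 : ν₀ Set.univ = 0 := by
      rw [hν₀ν, h0, zero_smul, Measure.coe_zero, Pi.zero_apply]
    rw [hν₀univ] at h1
    rcases mul_eq_zero.mp h1 with h2 | h2
    · exact hμ0 h2
    · exact hSL0 (Measure.measure_univ_eq_zero.mp h2)
  have hc0' : ((c : ℝ≥0) : ℝ≥0∞) ≠ 0 := by exact_mod_cast hc0
  have hKfin : ((c : ℝ≥0) : ℝ≥0∞)⁻¹ * μ Set.univ < ⊤ :=
    ENNReal.mul_lt_top (ENNReal.inv_lt_top.mpr (pos_iff_ne_zero.mpr hc0')) hμfin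
  refine ⟨((((c : ℝ≥0) : ℝ≥0∞)⁻¹ * μ Set.univ).toReal) * C, fun ρ hρ => ?_⟩
  have h1 : ν₀ {g | ∑ i : Fin 2, ∑ j : Fin 2, ‖((g : GL (Fin 2) ℂ) : Matrix (Fin 2) (Fin 2) ℂ) i j‖ ^ 2 ≤ ρ} =
      ((c : ℝ≥0) : ℝ≥0∞) * ν {g | ∑ i : Fin 2, ∑ j : Fin 2, ‖((g : GL (Fin 2) ℂ) : Matrix (Fin 2) (Fin 2) ℂ) i j‖ ^ 2 ≤ ρ} := by
    conv_lhs => rw [hν₀ν]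
    rw [Measure.smul_apply, ENNReal.smul_def, smul_eq_mul]
  have key : ν {g | ∑ i : Fin 2, ∑ j : Fin 2, ‖((g : GL (Fin 2) ℂ) : Matrix (Fin 2) (Fin 2) ℂ) i j‖ ^ 2 ≤ ρ} =
      ((c : ℝ≥0) : ℝ≥0∞)⁻¹ * ν₀ {g | ∑ i : Fin 2, ∑ j : Fin 2, ‖((g : GL (Fin 2) ℂ) : Matrix (Fin 2) (Fin 2) ℂ) i j‖ ^ 2 ≤ ρ} := by
    rw [h1, ← mul_assoc, ENNReal.inv_mul_cancel hc0' ENNReal.coe_ne_top, one_mul]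
  calc ν {g | ∑ i : Fin 2, ∑ j : Fin 2, ‖((g : GL (Fin 2) ℂ) : Matrix (Fin 2) (Fin 2) ℂ) i j‖ ^ 2 ≤ ρ}
      = ((c : ℝ≥0) : ℝ≥0∞)⁻¹ * ν₀ {g | ∑ i : Fin 2, ∑ j : Fin 2, ‖((g : GL (Fin 2) ℂ) : Matrix (Fin 2) (Fin 2) ℂ) i j‖ ^ 2 ≤ ρ} := key
    _ ≤ ((c : ℝ≥0) : ℝ≥0∞)⁻¹ *
          (μ Set.univ * iwasawaMeasure {r : Matrix (Fin 2) (Fin 2) ℝ | ∑ i : Fin 2, ∑ j : Fin 2, r i j ^ 2 ≤ ρ}) := by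
        gcongr; exact hball ρ
    _ ≤ ((c : ℝ≥0) : ℝ≥0∞)⁻¹ * (μ Set.univ * ENNReal.ofReal (C * ρ)) := by
        gcongr; exact hC ρ hρ
    _ = ENNReal.ofReal ((((c : ℝ≥0) : ℝ≥0∞)⁻¹ * μ Set.univ).toReal * C * ρ) := by
        rw [← mul_assoc, mul_assoc ((((c : ℝ≥0) : ℝ≥0∞)⁻¹ * μ Set.univ).toReal) C ρ,
          ENNReal.ofReal_mul ENNReal.toReal_nonneg, ENNReal.ofReal_toReal hKfin.ne]

end UnitaryCarrier

/-! ## §6 (ED. 3) «(T2-out)» over the field-free carrier, unconditional — the `hT2` input of ★ `ArchHSBallVolumeProduct` §3 by NAME -/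

section UnconditionalUnitary

open Literature.NumberTheory.Automorphic

/-- **«(T2-out)» over `↥(unitaryGroupOfForm (starRingEnd ℂ) Φ₂)`, UNCONDITIONAL** — exactly the hypothesis `hT2` of LH3-p03's ★ `haar_hsWeight_succ_le_of_unitaryGroupOfForm` ∕
`haar_setOf_archHSGL_endoEmbArch_le` (★ p848675 §3): for every Borel structure and every Haar measure `ν` on the `Φ₂`-unitary group of `ℂ²`,
`∃ C, ∀ ρ ≥ 2, ν {g ∣ Σ |g_ij|² ≤ ρ} ≤ C ρ` (§5 with the ★ `SL₂(ℝ)` inputs of §3). [cite: BeuzartPlessis2020Asterisque, §1.5 (1.5.2)–(1.5.3) p. 31]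
[cite: Borel1997, §2.3; §4.1 (1)–(3)] -/
theorem haar_unitaryGroupOfForm_antidiag_two_hsBall_le_linear
    [MeasurableSpace ↥(unitaryGroupOfForm (starRingEnd ℂ) (Matrix.of fun i j : Fin 2 => if i.val + j.val + 1 = 2 then (1 : ℂ) else 0))]
    [BorelSpace ↥(unitaryGroupOfForm (starRingEnd ℂ) (Matrix.of fun i j : Fin 2 => if i.val + j.val + 1 = 2 then (1 : ℂ) else 0))]
    (ν : Measure ↥(unitaryGroupOfForm (starRingEnd ℂ) (Matrix.of fun i j : Fin 2 => if i.val + j.val + 1 = 2 then (1 : ℂ) else 0))) [ν.IsHaarMeasure] :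
    ∃ C : ℝ, ∀ ρ : ℝ, 2 ≤ ρ →
      ν {g | ∑ i : Fin 2, ∑ j : Fin 2, ‖((g : GL (Fin 2) ℂ) : Matrix (Fin 2) (Fin 2) ℂ) i j‖ ^ 2 ≤ ρ} ≤ ENNReal.ofReal (C * ρ) := by
  letI : MeasurableSpace (Matrix (Fin 2) (Fin 2) ℝ) := borel _
  haveI : BorelSpace (Matrix (Fin 2) (Fin 2) ℝ) := ⟨rfl⟩
  exact haar_unitaryGroupOfForm_antidiag_two_hsBall_le exists_iwasawaMeasure_hsBall_le_linear iwasawaMeasure_ne_zero ν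

end UnconditionalUnitary


/-! ## §7 (ED. 4) The Haar measures of the place carrier read on matrix sets through the lift (exported comparison; LH2-p04's (VOL-split-measure) input) -/

section Export

open NumberField NumberField.InfinitePlace Literature.NumberTheory.Automorphic Literature.NumberTheory.Automorphic.UnitaryGroup

variable (L : Type) [Field L] (w : {w : InfinitePlace L // w.IsComplex})
  [MeasurableSpace (Matrix (Fin 2) (Fin 2) ℝ)] [BorelSpace (Matrix (Fin 2) (Fin 2) ℝ)] [MeasurableSpace Circle] [BorelSpace Circle]
  [MeasurableSpace (Matrix (Fin 2) (Fin 2) ℂ)] [BorelSpace (Matrix (Fin 2) (Fin 2) ℂ)]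
  [MeasurableSpace ↥(archLocal L 2 (Matrix.of fun i j : Fin 2 => if i.val + j.val + 1 = 2 then (1 : L) else 0) w)]
  [BorelSpace ↥(archLocal L 2 (Matrix.of fun i j : Fin 2 => if i.val + j.val + 1 = 2 then (1 : L) else 0) w)]

/-- **THE HAAR MEASURES OF `U(Φ₂)(ℂ)_w` READ ON MATRIX SETS THROUGH THE `S¹ × SL₂(ℝ)` LIFT** (the comparison behind «(T2-out)», exported for LH2's split-class
volume reading): for every Haar `μ` on `S¹` and every Haar `ν` on the place carrier `archLocal L 2 Φ₂ w` there is `κ ∈ (0, ∞)` with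
`ν {g ∣ (g : M₂(ℂ)) ∈ S} = κ · (μ ⊗ iwasawaMeasure) {(z, r) ∣ archPlaneLift z r ∈ S}` for every measurable `S ⊆ M₂(ℂ)` (push-forward of `μ ⊗ iwasawaMeasure` along
the lift = `κ⁻¹ • ν` by uniqueness of Haar measure; `det r = 1` a.e.). [cite: BeuzartPlessis2020Asterisque, §1.5 (1.5.2)–(1.5.3) p. 31] [cite: Borel1997, §2.3; §4.1 (1)–(3)] -/
theorem exists_measure_archLocal_two_eq_mul_prod_preimage_archPlaneLift (μ : Measure Circle) [μ.IsHaarMeasure]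
    (ν : Measure ↥(archLocal L 2 (Matrix.of fun i j : Fin 2 => if i.val + j.val + 1 = 2 then (1 : L) else 0) w)) [ν.IsHaarMeasure] :
    ∃ κ : ℝ≥0∞, κ ≠ 0 ∧ κ ≠ ⊤ ∧ ∀ S : Set (Matrix (Fin 2) (Fin 2) ℂ), MeasurableSet S →
      ν {g | ((g : GL (Fin 2) ℂ) : Matrix (Fin 2) (Fin 2) ℂ) ∈ S} = κ * (μ.prod iwasawaMeasure) {p | archPlaneLift (p.1 : ℂ) p.2 ∈ S} := by
  haveI : SFinite (iwasawaMeasure : Measure (Matrix (Fin 2) (Fin 2) ℝ)) := by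
    unfold iwasawaMeasure; infer_instance
  haveI := locallyCompactSpace_archLocal L 2 (Matrix.of fun i j : Fin 2 => if i.val + j.val + 1 = 2 then (1 : L) else 0) w
  haveI := secondCountableTopology_archLocal L 2 (Matrix.of fun i j : Fin 2 => if i.val + j.val + 1 = 2 then (1 : L) else 0) w
  obtain ⟨C, hC⟩ :
      ∃ C : ℝ, ∀ ρ : ℝ, 2 ≤ ρ → iwasawaMeasure {r : Matrix (Fin 2) (Fin 2) ℝ | ∑ i : Fin 2, ∑ j : Fin 2, r i j ^ 2 ≤ ρ} ≤ ENNReal.ofReal (C * ρ) :=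
    exists_iwasawaMeasure_hsBall_le_linear
  have hSL0 : (iwasawaMeasure : Measure (Matrix (Fin 2) (Fin 2) ℝ)) ≠ 0 := iwasawaMeasure_ne_zero
  -- the product measure
  set m : Measure (Circle × Matrix (Fin 2) (Fin 2) ℝ) := μ.prod iwasawaMeasure with hm
  set ν₀ : Measure ↥(archLocal L 2 (Matrix.of fun i j : Fin 2 => if i.val + j.val + 1 = 2 then (1 : L) else 0) w) :=
    Measure.map (archPlaneLiftLocal L w) m with hν₀
  have hμfin : μ Set.univ < ⊤ := IsCompact.measure_lt_top isCompact_univ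
  -- HS-balls are closed
  have hHS : Continuous fun g : ↥(archLocal L 2 (Matrix.of fun i j : Fin 2 => if i.val + j.val + 1 = 2 then (1 : L) else 0) w) =>
      ∑ i : Fin 2, ∑ j : Fin 2, ‖((g : GL (Fin 2) ℂ) : Matrix (Fin 2) (Fin 2) ℂ) i j‖ ^ 2 := by
    have hv : Continuous fun g : ↥(archLocal L 2 (Matrix.of fun i j : Fin 2 => if i.val + j.val + 1 = 2 then (1 : L) else 0) w) =>
        ((g : GL (Fin 2) ℂ) : Matrix (Fin 2) (Fin 2) ℂ) := Units.continuous_val.comp continuous_subtype_val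
    exact continuous_finsetSum _ fun i _ => continuous_finsetSum _ fun j _ => (((continuous_apply j).comp (continuous_apply i)).comp hv).norm.pow 2
  have hBmeas : ∀ ρ : ℝ, MeasurableSet {g : ↥(archLocal L 2 (Matrix.of fun i j : Fin 2 => if i.val + j.val + 1 = 2 then (1 : L) else 0) w) |
      ∑ i : Fin 2, ∑ j : Fin 2, ‖((g : GL (Fin 2) ℂ) : Matrix (Fin 2) (Fin 2) ℂ) i j‖ ^ 2 ≤ ρ} :=
    fun ρ => (isClosed_le hHS continuous_const).measurableSet
  -- (1) the HS-balls of `ν₀`: preimage ⊆ `S¹ × {Σ r² ≤ ρ}` up to the null set `det r ≠ 1`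
  have hball : ∀ ρ : ℝ, ν₀ {g | ∑ i : Fin 2, ∑ j : Fin 2, ‖((g : GL (Fin 2) ℂ) : Matrix (Fin 2) (Fin 2) ℂ) i j‖ ^ 2 ≤ ρ} ≤
      μ Set.univ * iwasawaMeasure {r : Matrix (Fin 2) (Fin 2) ℝ | ∑ i : Fin 2, ∑ j : Fin 2, r i j ^ 2 ≤ ρ} := by
    intro ρ
    rw [hν₀, Measure.map_apply (measurable_archPlaneLiftLocal L w) (hBmeas ρ)]
    calc m (archPlaneLiftLocal L w ⁻¹' {g | ∑ i : Fin 2, ∑ j : Fin 2, ‖((g : GL (Fin 2) ℂ) : Matrix (Fin 2) (Fin 2) ℂ) i j‖ ^ 2 ≤ ρ})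
        ≤ m (((Set.univ : Set Circle) ×ˢ {r : Matrix (Fin 2) (Fin 2) ℝ | ∑ i : Fin 2, ∑ j : Fin 2, r i j ^ 2 ≤ ρ}) ∪
            ((Set.univ : Set Circle) ×ˢ {r : Matrix (Fin 2) (Fin 2) ℝ | r.det = 1}ᶜ)) := by
          refine measure_mono fun p hp => ?_
          by_cases hdet : p.2.det = 1
          · left
            refine ⟨Set.mem_univ _, ?_⟩
            simp only [Set.mem_preimage, Set.mem_setOf_eq] at hp
            rw [coe_archPlaneLiftLocal L w hdet, hs_archPlaneLift (Circle.norm_coe p.1)] at hp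
            exact hp
          · right
            exact ⟨Set.mem_univ _, hdet⟩
      _ ≤ m ((Set.univ : Set Circle) ×ˢ {r : Matrix (Fin 2) (Fin 2) ℝ | ∑ i : Fin 2, ∑ j : Fin 2, r i j ^ 2 ≤ ρ}) +
            m ((Set.univ : Set Circle) ×ˢ {r : Matrix (Fin 2) (Fin 2) ℝ | r.det = 1}ᶜ) := measure_union_le _ _
      _ = μ Set.univ * iwasawaMeasure {r : Matrix (Fin 2) (Fin 2) ℝ | ∑ i : Fin 2, ∑ j : Fin 2, r i j ^ 2 ≤ ρ} := by
          rw [hm, Measure.prod_prod, Measure.prod_prod, iwasawaMeasure_compl_det_one, mul_zero, add_zero]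
  -- (2) `ν₀` is left invariant
  haveI hinv : ν₀.IsMulLeftInvariant := by
    refine ⟨fun x => ?_⟩
    -- `x = lift (z₀, r₀)`
    obtain ⟨z₀, r₀, hz₀, hr₀, hx⟩ := exists_archPlaneLift_eq_of_unitary ((mem_archLocal_antidiag_two_iff L w _).1 x.2)
    let ζ₀ : Circle := ⟨z₀, mem_sphere_zero_iff_norm.2 hz₀⟩
    have hmulx : Measurable fun g : ↥(archLocal L 2 (Matrix.of fun i j : Fin 2 => if i.val + j.val + 1 = 2 then (1 : L) else 0) w) => x * g :=
      (continuous_const.mul continuous_id).measurable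
    have hT : Measurable fun p : Circle × Matrix (Fin 2) (Fin 2) ℝ => (ζ₀ * p.1, r₀ * p.2) :=
      ((continuous_const.mul continuous_fst).prodMk ((continuous_const.matrix_mul continuous_id).comp continuous_snd)).measurable
    rw [hν₀, Measure.map_map hmulx (measurable_archPlaneLiftLocal L w)]
    -- a.e. `x * lift p = lift (ζ₀ z, r₀ r)`
    have hae : (fun g : ↥(archLocal L 2 (Matrix.of fun i j : Fin 2 => if i.val + j.val + 1 = 2 then (1 : L) else 0) w) => x * g) ∘
        archPlaneLiftLocal L w =ᵐ[m] archPlaneLiftLocal L w ∘ fun p => (ζ₀ * p.1, r₀ * p.2) := by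
      filter_upwards [ae_det_eq_one μ] with p hp
      have hp' : (r₀ * p.2).det = 1 := by rw [Matrix.det_mul, hr₀, hp, one_mul]
      apply Subtype.ext
      apply Units.ext
      simp only [Function.comp_apply, Subgroup.coe_mul, Units.val_mul]
      rw [coe_archPlaneLiftLocal L w hp, coe_archPlaneLiftLocal L w (p := (ζ₀ * p.1, r₀ * p.2)) hp', hx, Circle.coe_mul,
        archPlaneLift_mul]
    rw [Measure.map_congr hae, ← Measure.map_map (measurable_archPlaneLiftLocal L w) hT]
    congr 1
    have hprod : (fun p : Circle × Matrix (Fin 2) (Fin 2) ℝ => (ζ₀ * p.1, r₀ * p.2)) = Prod.map (fun z => ζ₀ * z) fun g => r₀ * g := rfl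
    rw [hm, hprod, ← Measure.map_prod_map _ _ (measurable_const_mul ζ₀) (measurable_mul_left r₀), map_mul_left_eq_self,
      map_mul_left_iwasawaMeasure ⟨r₀, hr₀⟩]
  -- (3) `ν₀` is finite on compacts (a compact set lies in an HS-ball)
  haveI hfin : IsFiniteMeasureOnCompacts ν₀ := by
    refine ⟨fun K hK => ?_⟩
    obtain ⟨R, hR⟩ := hK.bddAbove_image hHS.continuousOn
    have hsub : K ⊆ {g | ∑ i : Fin 2, ∑ j : Fin 2, ‖((g : GL (Fin 2) ℂ) : Matrix (Fin 2) (Fin 2) ℂ) i j‖ ^ 2 ≤ max R 2} :=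
      fun g hg => (hR ⟨g, hg, rfl⟩).trans (le_max_left _ _)
    calc ν₀ K ≤ ν₀ {g | ∑ i : Fin 2, ∑ j : Fin 2, ‖((g : GL (Fin 2) ℂ) : Matrix (Fin 2) (Fin 2) ℂ) i j‖ ^ 2 ≤ max R 2} := measure_mono hsub
      _ ≤ μ Set.univ * iwasawaMeasure {r : Matrix (Fin 2) (Fin 2) ℝ | ∑ i : Fin 2, ∑ j : Fin 2, r i j ^ 2 ≤ max R 2} := hball _
      _ ≤ μ Set.univ * ENNReal.ofReal (C * max R 2) := by gcongr; exact hC _ (le_max_right _ _)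
      _ < ⊤ := ENNReal.mul_lt_top hμfin ENNReal.ofReal_lt_top
  -- (4) uniqueness of Haar measure: `ν₀ = c • ν` with `c ≠ 0`
  have hν₀ν : ν₀ = ν₀.haarScalarFactor ν • ν := Measure.isMulLeftInvariant_eq_smul ν₀ ν
  set c : ℝ≥0 := ν₀.haarScalarFactor ν with hc
  have hμ0 : μ Set.univ ≠ 0 := (isOpen_univ.measure_pos μ Set.univ_nonempty).ne'
  have hν₀univ : ν₀ Set.univ = μ Set.univ * iwasawaMeasure Set.univ := by
    rw [hν₀, Measure.map_apply (measurable_archPlaneLiftLocal L w) MeasurableSet.univ, Set.preimage_univ, hm,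
      ← Set.univ_prod_univ, Measure.prod_prod]
  have hc0 : c ≠ 0 := by
    intro h0
    have h1 : ν₀ Set.univ = 0 := by
      rw [hν₀ν, h0, zero_smul, Measure.coe_zero, Pi.zero_apply]
    rw [hν₀univ] at h1
    rcases mul_eq_zero.mp h1 with h2 | h2
    · exact hμ0 h2
    · exact hSL0 (Measure.measure_univ_eq_zero.mp h2)
  have hc0' : ((c : ℝ≥0) : ℝ≥0∞) ≠ 0 := by exact_mod_cast hc0

  -- (5) the comparison on matrix sets
  refine ⟨((c : ℝ≥0) : ℝ≥0∞)⁻¹, ENNReal.inv_ne_zero.mpr ENNReal.coe_ne_top, ENNReal.inv_ne_top.mpr hc0', fun S hS => ?_⟩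
  have hcoe : Measurable fun g : ↥(archLocal L 2 (Matrix.of fun i j : Fin 2 => if i.val + j.val + 1 = 2 then (1 : L) else 0) w) => ((g : GL (Fin 2) ℂ) : Matrix (Fin 2) (Fin 2) ℂ) :=
    (Units.continuous_val.comp continuous_subtype_val).measurable
  have hT : MeasurableSet {g : ↥(archLocal L 2 (Matrix.of fun i j : Fin 2 => if i.val + j.val + 1 = 2 then (1 : L) else 0) w) | ((g : GL (Fin 2) ℂ) : Matrix (Fin 2) (Fin 2) ℂ) ∈ S} := hcoe hS
  have h1 : ν₀ {g : ↥(archLocal L 2 (Matrix.of fun i j : Fin 2 => if i.val + j.val + 1 = 2 then (1 : L) else 0) w) | ((g : GL (Fin 2) ℂ) : Matrix (Fin 2) (Fin 2) ℂ) ∈ S} =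
      ((c : ℝ≥0) : ℝ≥0∞) * ν {g : ↥(archLocal L 2 (Matrix.of fun i j : Fin 2 => if i.val + j.val + 1 = 2 then (1 : L) else 0) w) | ((g : GL (Fin 2) ℂ) : Matrix (Fin 2) (Fin 2) ℂ) ∈ S} := by
    conv_lhs => rw [hν₀ν]
    rw [Measure.smul_apply, ENNReal.smul_def, smul_eq_mul]
  have h2 : ν₀ {g : ↥(archLocal L 2 (Matrix.of fun i j : Fin 2 => if i.val + j.val + 1 = 2 then (1 : L) else 0) w) | ((g : GL (Fin 2) ℂ) : Matrix (Fin 2) (Fin 2) ℂ) ∈ S} = m {p | archPlaneLift (p.1 : ℂ) p.2 ∈ S} := by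
    rw [hν₀, Measure.map_apply (measurable_archPlaneLiftLocal L w) hT]
    refine measure_congr ?_
    filter_upwards [ae_det_eq_one μ] with p hp
    show (p ∈ archPlaneLiftLocal L w ⁻¹' {g | ((g : GL (Fin 2) ℂ) : Matrix (Fin 2) (Fin 2) ℂ) ∈ S}) =
      (p ∈ {p : Circle × Matrix (Fin 2) (Fin 2) ℝ | archPlaneLift (p.1 : ℂ) p.2 ∈ S})
    simp only [Set.mem_preimage, Set.mem_setOf_eq]
    rw [coe_archPlaneLiftLocal L w hp]
  rw [← h2, h1, ← mul_assoc, ENNReal.inv_mul_cancel hc0' ENNReal.coe_ne_top, one_mul]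

end Export


/-! ## §8 (ED. 4) The same export over the field-free carrier `↥(unitaryGroupOfForm (starRingEnd ℂ) Φ₂)` -/

section ExportUnitary

open NumberField NumberField.InfinitePlace Literature.NumberTheory.Automorphic Literature.NumberTheory.Automorphic.UnitaryGroup

variable [MeasurableSpace (Matrix (Fin 2) (Fin 2) ℝ)] [BorelSpace (Matrix (Fin 2) (Fin 2) ℝ)] [MeasurableSpace Circle] [BorelSpace Circle]
  [MeasurableSpace (Matrix (Fin 2) (Fin 2) ℂ)] [BorelSpace (Matrix (Fin 2) (Fin 2) ℂ)]
  [MeasurableSpace ↥(unitaryGroupOfForm (starRingEnd ℂ) (Matrix.of fun i j : Fin 2 => if i.val + j.val + 1 = 2 then (1 : ℂ) else 0))]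
  [BorelSpace ↥(unitaryGroupOfForm (starRingEnd ℂ) (Matrix.of fun i j : Fin 2 => if i.val + j.val + 1 = 2 then (1 : ℂ) else 0))]

/-- **THE HAAR MEASURES OF `U(Φ₂)(ℂ)_w` READ ON MATRIX SETS THROUGH THE `S¹ × SL₂(ℝ)` LIFT** (the comparison behind «(T2-out)», exported for LH2's split-class
volume reading): for every Haar `μ` on `S¹` and every Haar `ν` on the `Φ₂`-unitary group `↥(unitaryGroupOfForm (starRingEnd ℂ) Φ₂)` there is `κ ∈ (0, ∞)` with
`ν {g ∣ (g : M₂(ℂ)) ∈ S} = κ · (μ ⊗ iwasawaMeasure) {(z, r) ∣ archPlaneLift z r ∈ S}` for every measurable `S ⊆ M₂(ℂ)` (push-forward of `μ ⊗ iwasawaMeasure` along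
the lift = `κ⁻¹ • ν` by uniqueness of Haar measure; `det r = 1` a.e.). [cite: BeuzartPlessis2020Asterisque, §1.5 (1.5.2)–(1.5.3) p. 31] [cite: Borel1997, §2.3; §4.1 (1)–(3)] -/
theorem exists_measure_unitaryGroupOfForm_antidiag_two_eq_mul_prod_preimage_archPlaneLift (μ : Measure Circle) [μ.IsHaarMeasure]
    (ν : Measure ↥(unitaryGroupOfForm (starRingEnd ℂ) (Matrix.of fun i j : Fin 2 => if i.val + j.val + 1 = 2 then (1 : ℂ) else 0))) [ν.IsHaarMeasure] :
    ∃ κ : ℝ≥0∞, κ ≠ 0 ∧ κ ≠ ⊤ ∧ ∀ S : Set (Matrix (Fin 2) (Fin 2) ℂ), MeasurableSet S →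
      ν {g | ((g : GL (Fin 2) ℂ) : Matrix (Fin 2) (Fin 2) ℂ) ∈ S} = κ * (μ.prod iwasawaMeasure) {p | archPlaneLift (p.1 : ℂ) p.2 ∈ S} := by
  haveI : SFinite (iwasawaMeasure : Measure (Matrix (Fin 2) (Fin 2) ℝ)) := by
    unfold iwasawaMeasure; infer_instance
  haveI := locallyCompactSpace_unitaryGroupOfForm_complex (Matrix.of fun i j : Fin 2 => if i.val + j.val + 1 = 2 then (1 : ℂ) else 0)
  haveI := secondCountableTopology_unitaryGroupOfForm_complex (Matrix.of fun i j : Fin 2 => if i.val + j.val + 1 = 2 then (1 : ℂ) else 0)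
  obtain ⟨C, hC⟩ :
      ∃ C : ℝ, ∀ ρ : ℝ, 2 ≤ ρ → iwasawaMeasure {r : Matrix (Fin 2) (Fin 2) ℝ | ∑ i : Fin 2, ∑ j : Fin 2, r i j ^ 2 ≤ ρ} ≤ ENNReal.ofReal (C * ρ) :=
    exists_iwasawaMeasure_hsBall_le_linear
  have hSL0 : (iwasawaMeasure : Measure (Matrix (Fin 2) (Fin 2) ℝ)) ≠ 0 := iwasawaMeasure_ne_zero
  -- the product measure
  set m : Measure (Circle × Matrix (Fin 2) (Fin 2) ℝ) := μ.prod iwasawaMeasure with hm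
  set ν₀ : Measure ↥(unitaryGroupOfForm (starRingEnd ℂ) (Matrix.of fun i j : Fin 2 => if i.val + j.val + 1 = 2 then (1 : ℂ) else 0)) :=
    Measure.map (archPlaneLiftUnitary) m with hν₀
  have hμfin : μ Set.univ < ⊤ := IsCompact.measure_lt_top isCompact_univ
  -- HS-balls are closed
  have hHS : Continuous fun g : ↥(unitaryGroupOfForm (starRingEnd ℂ) (Matrix.of fun i j : Fin 2 => if i.val + j.val + 1 = 2 then (1 : ℂ) else 0)) =>
      ∑ i : Fin 2, ∑ j : Fin 2, ‖((g : GL (Fin 2) ℂ) : Matrix (Fin 2) (Fin 2) ℂ) i j‖ ^ 2 := by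
    have hv : Continuous fun g : ↥(unitaryGroupOfForm (starRingEnd ℂ) (Matrix.of fun i j : Fin 2 => if i.val + j.val + 1 = 2 then (1 : ℂ) else 0)) =>
        ((g : GL (Fin 2) ℂ) : Matrix (Fin 2) (Fin 2) ℂ) := Units.continuous_val.comp continuous_subtype_val
    exact continuous_finsetSum _ fun i _ => continuous_finsetSum _ fun j _ => (((continuous_apply j).comp (continuous_apply i)).comp hv).norm.pow 2
  have hBmeas : ∀ ρ : ℝ, MeasurableSet {g : ↥(unitaryGroupOfForm (starRingEnd ℂ) (Matrix.of fun i j : Fin 2 => if i.val + j.val + 1 = 2 then (1 : ℂ) else 0)) |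
      ∑ i : Fin 2, ∑ j : Fin 2, ‖((g : GL (Fin 2) ℂ) : Matrix (Fin 2) (Fin 2) ℂ) i j‖ ^ 2 ≤ ρ} :=
    fun ρ => (isClosed_le hHS continuous_const).measurableSet
  -- (1) the HS-balls of `ν₀`: preimage ⊆ `S¹ × {Σ r² ≤ ρ}` up to the null set `det r ≠ 1`
  have hball : ∀ ρ : ℝ, ν₀ {g | ∑ i : Fin 2, ∑ j : Fin 2, ‖((g : GL (Fin 2) ℂ) : Matrix (Fin 2) (Fin 2) ℂ) i j‖ ^ 2 ≤ ρ} ≤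
      μ Set.univ * iwasawaMeasure {r : Matrix (Fin 2) (Fin 2) ℝ | ∑ i : Fin 2, ∑ j : Fin 2, r i j ^ 2 ≤ ρ} := by
    intro ρ
    rw [hν₀, Measure.map_apply measurable_archPlaneLiftUnitary (hBmeas ρ)]
    calc m (archPlaneLiftUnitary ⁻¹' {g | ∑ i : Fin 2, ∑ j : Fin 2, ‖((g : GL (Fin 2) ℂ) : Matrix (Fin 2) (Fin 2) ℂ) i j‖ ^ 2 ≤ ρ})
        ≤ m (((Set.univ : Set Circle) ×ˢ {r : Matrix (Fin 2) (Fin 2) ℝ | ∑ i : Fin 2, ∑ j : Fin 2, r i j ^ 2 ≤ ρ}) ∪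
            ((Set.univ : Set Circle) ×ˢ {r : Matrix (Fin 2) (Fin 2) ℝ | r.det = 1}ᶜ)) := by
          refine measure_mono fun p hp => ?_
          by_cases hdet : p.2.det = 1
          · left
            refine ⟨Set.mem_univ _, ?_⟩
            simp only [Set.mem_preimage, Set.mem_setOf_eq] at hp
            rw [coe_archPlaneLiftUnitary hdet, hs_archPlaneLift (Circle.norm_coe p.1)] at hp
            exact hp
          · right
            exact ⟨Set.mem_univ _, hdet⟩
      _ ≤ m ((Set.univ : Set Circle) ×ˢ {r : Matrix (Fin 2) (Fin 2) ℝ | ∑ i : Fin 2, ∑ j : Fin 2, r i j ^ 2 ≤ ρ}) +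
            m ((Set.univ : Set Circle) ×ˢ {r : Matrix (Fin 2) (Fin 2) ℝ | r.det = 1}ᶜ) := measure_union_le _ _
      _ = μ Set.univ * iwasawaMeasure {r : Matrix (Fin 2) (Fin 2) ℝ | ∑ i : Fin 2, ∑ j : Fin 2, r i j ^ 2 ≤ ρ} := by
          rw [hm, Measure.prod_prod, Measure.prod_prod, iwasawaMeasure_compl_det_one, mul_zero, add_zero]
  -- (2) `ν₀` is left invariant
  haveI hinv : ν₀.IsMulLeftInvariant := by
    refine ⟨fun x => ?_⟩
    -- `x = lift (z₀, r₀)`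
    obtain ⟨z₀, r₀, hz₀, hr₀, hx⟩ := exists_archPlaneLift_eq_of_unitary x.2
    let ζ₀ : Circle := ⟨z₀, mem_sphere_zero_iff_norm.2 hz₀⟩
    have hmulx : Measurable fun g : ↥(unitaryGroupOfForm (starRingEnd ℂ) (Matrix.of fun i j : Fin 2 => if i.val + j.val + 1 = 2 then (1 : ℂ) else 0)) => x * g :=
      (continuous_const.mul continuous_id).measurable
    have hT : Measurable fun p : Circle × Matrix (Fin 2) (Fin 2) ℝ => (ζ₀ * p.1, r₀ * p.2) :=
      ((continuous_const.mul continuous_fst).prodMk ((continuous_const.matrix_mul continuous_id).comp continuous_snd)).measurable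
    rw [hν₀, Measure.map_map hmulx measurable_archPlaneLiftUnitary]
    -- a.e. `x * lift p = lift (ζ₀ z, r₀ r)`
    have hae : (fun g : ↥(unitaryGroupOfForm (starRingEnd ℂ) (Matrix.of fun i j : Fin 2 => if i.val + j.val + 1 = 2 then (1 : ℂ) else 0)) => x * g) ∘
        archPlaneLiftUnitary =ᵐ[m] archPlaneLiftUnitary ∘ fun p => (ζ₀ * p.1, r₀ * p.2) := by
      filter_upwards [ae_det_eq_one μ] with p hp
      have hp' : (r₀ * p.2).det = 1 := by rw [Matrix.det_mul, hr₀, hp, one_mul]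
      apply Subtype.ext
      apply Units.ext
      simp only [Function.comp_apply, Subgroup.coe_mul, Units.val_mul]
      rw [coe_archPlaneLiftUnitary hp, coe_archPlaneLiftUnitary (p := (ζ₀ * p.1, r₀ * p.2)) hp', hx, Circle.coe_mul,
        archPlaneLift_mul]
    rw [Measure.map_congr hae, ← Measure.map_map measurable_archPlaneLiftUnitary hT]
    congr 1
    have hprod : (fun p : Circle × Matrix (Fin 2) (Fin 2) ℝ => (ζ₀ * p.1, r₀ * p.2)) = Prod.map (fun z => ζ₀ * z) fun g => r₀ * g := rfl
    rw [hm, hprod, ← Measure.map_prod_map _ _ (measurable_const_mul ζ₀) (measurable_mul_left r₀), map_mul_left_eq_self,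
      map_mul_left_iwasawaMeasure ⟨r₀, hr₀⟩]
  -- (3) `ν₀` is finite on compacts (a compact set lies in an HS-ball)
  haveI hfin : IsFiniteMeasureOnCompacts ν₀ := by
    refine ⟨fun K hK => ?_⟩
    obtain ⟨R, hR⟩ := hK.bddAbove_image hHS.continuousOn
    have hsub : K ⊆ {g | ∑ i : Fin 2, ∑ j : Fin 2, ‖((g : GL (Fin 2) ℂ) : Matrix (Fin 2) (Fin 2) ℂ) i j‖ ^ 2 ≤ max R 2} :=
      fun g hg => (hR ⟨g, hg, rfl⟩).trans (le_max_left _ _)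
    calc ν₀ K ≤ ν₀ {g | ∑ i : Fin 2, ∑ j : Fin 2, ‖((g : GL (Fin 2) ℂ) : Matrix (Fin 2) (Fin 2) ℂ) i j‖ ^ 2 ≤ max R 2} := measure_mono hsub
      _ ≤ μ Set.univ * iwasawaMeasure {r : Matrix (Fin 2) (Fin 2) ℝ | ∑ i : Fin 2, ∑ j : Fin 2, r i j ^ 2 ≤ max R 2} := hball _
      _ ≤ μ Set.univ * ENNReal.ofReal (C * max R 2) := by gcongr; exact hC _ (le_max_right _ _)
      _ < ⊤ := ENNReal.mul_lt_top hμfin ENNReal.ofReal_lt_top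
  -- (4) uniqueness of Haar measure: `ν₀ = c • ν` with `c ≠ 0`
  have hν₀ν : ν₀ = ν₀.haarScalarFactor ν • ν := Measure.isMulLeftInvariant_eq_smul ν₀ ν
  set c : ℝ≥0 := ν₀.haarScalarFactor ν with hc
  have hμ0 : μ Set.univ ≠ 0 := (isOpen_univ.measure_pos μ Set.univ_nonempty).ne'
  have hν₀univ : ν₀ Set.univ = μ Set.univ * iwasawaMeasure Set.univ := by
    rw [hν₀, Measure.map_apply measurable_archPlaneLiftUnitary MeasurableSet.univ, Set.preimage_univ, hm,
      ← Set.univ_prod_univ, Measure.prod_prod]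
  have hc0 : c ≠ 0 := by
    intro h0
    have h1 : ν₀ Set.univ = 0 := by
      rw [hν₀ν, h0, zero_smul, Measure.coe_zero, Pi.zero_apply]
    rw [hν₀univ] at h1
    rcases mul_eq_zero.mp h1 with h2 | h2
    · exact hμ0 h2
    · exact hSL0 (Measure.measure_univ_eq_zero.mp h2)
  have hc0' : ((c : ℝ≥0) : ℝ≥0∞) ≠ 0 := by exact_mod_cast hc0

  -- (5) the comparison on matrix sets
  refine ⟨((c : ℝ≥0) : ℝ≥0∞)⁻¹, ENNReal.inv_ne_zero.mpr ENNReal.coe_ne_top, ENNReal.inv_ne_top.mpr hc0', fun S hS => ?_⟩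
  have hcoe : Measurable fun g : ↥(unitaryGroupOfForm (starRingEnd ℂ) (Matrix.of fun i j : Fin 2 => if i.val + j.val + 1 = 2 then (1 : ℂ) else 0)) => ((g : GL (Fin 2) ℂ) : Matrix (Fin 2) (Fin 2) ℂ) :=
    (Units.continuous_val.comp continuous_subtype_val).measurable
  have hT : MeasurableSet {g : ↥(unitaryGroupOfForm (starRingEnd ℂ) (Matrix.of fun i j : Fin 2 => if i.val + j.val + 1 = 2 then (1 : ℂ) else 0)) | ((g : GL (Fin 2) ℂ) : Matrix (Fin 2) (Fin 2) ℂ) ∈ S} := hcoe hS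
  have h1 : ν₀ {g : ↥(unitaryGroupOfForm (starRingEnd ℂ) (Matrix.of fun i j : Fin 2 => if i.val + j.val + 1 = 2 then (1 : ℂ) else 0)) | ((g : GL (Fin 2) ℂ) : Matrix (Fin 2) (Fin 2) ℂ) ∈ S} =
      ((c : ℝ≥0) : ℝ≥0∞) * ν {g : ↥(unitaryGroupOfForm (starRingEnd ℂ) (Matrix.of fun i j : Fin 2 => if i.val + j.val + 1 = 2 then (1 : ℂ) else 0)) | ((g : GL (Fin 2) ℂ) : Matrix (Fin 2) (Fin 2) ℂ) ∈ S} := by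
    conv_lhs => rw [hν₀ν]
    rw [Measure.smul_apply, ENNReal.smul_def, smul_eq_mul]
  have h2 : ν₀ {g : ↥(unitaryGroupOfForm (starRingEnd ℂ) (Matrix.of fun i j : Fin 2 => if i.val + j.val + 1 = 2 then (1 : ℂ) else 0)) | ((g : GL (Fin 2) ℂ) : Matrix (Fin 2) (Fin 2) ℂ) ∈ S} = m {p | archPlaneLift (p.1 : ℂ) p.2 ∈ S} := by
    rw [hν₀, Measure.map_apply measurable_archPlaneLiftUnitary hT]
    refine measure_congr ?_
    filter_upwards [ae_det_eq_one μ] with p hp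
    show (p ∈ archPlaneLiftUnitary ⁻¹' {g | ((g : GL (Fin 2) ℂ) : Matrix (Fin 2) (Fin 2) ℂ) ∈ S}) =
      (p ∈ {p : Circle × Matrix (Fin 2) (Fin 2) ℝ | archPlaneLift (p.1 : ℂ) p.2 ∈ S})
    simp only [Set.mem_preimage, Set.mem_setOf_eq]
    rw [coe_archPlaneLiftUnitary hp]
  rw [← h2, h1, ← mul_assoc, ENNReal.inv_mul_cancel hc0' ENNReal.coe_ne_top, one_mul]

end ExportUnitary

end Literature.NumberTheory.Rogawski1990

end
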